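import Literature.Geometry.Lorentzian.KerrSchildSymmHypCoefficients
import Literature.Geometry.Lorentzian.KerrLargeRWeight
import Mathlib.Analysis.Calculus.FDeriv.Symmetric
import Literature.Geometry.Lorentzian.SlabTransportUniqueness
import Literature.Geometry.Lorentzian.KerrSchildWaveCauchyReduction
import Literature.Analysis.PDE.SymmetricHyperbolicRegularised
import Literature.Geometry.Lorentzian.KerrSchildWaveCauchyAssembly
import HarnessLib

/-!
# `KerrSchild.waveCauchyProblem` reduced to Friedrichs' existence theorem for linear symmetric hyperbolic systems: John's first-order reduction of the wave equation on Kerr–Schild backgrounds (family `gr`)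

Continuation of `KerrSchildSymmHypCoefficients.lean` (the coefficient operators `S, S⁻¹, A⁰, Aᵏ, B, 𝔄ᵏ, 𝔅` of the
symmetrised first-order form `∂_t W = 𝔄ᵏ ∂_k W + 𝔅 W`, `W = S V`, `V = (q⃗, q₀, u)`, of the wave equation
`□_G u = 0` on a generalised Kerr–Schild background in lapse–shift variables). The end result is
`KerrSchild.waveCauchyProblem_of_symmHyperbolic` (Part 6): the named fact
`KerrSchild.waveCauchyProblem` (`KerrSchildWaveCauchyProblem.lean`) follows from the existence of
classical slab solutions of linear symmetric hyperbolic systems with admissible coefficients and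
`C_c^∞` data — the conclusion of Friedrichs' existence theorem, proved in
`Literature/Analysis/PDE/SymmetricHyperbolicExistence.lean` and combined with this file in
`KerrSchildWaveCauchyProblemProofs.lean`. Parts 1–2 derive the `3 + 1` system, its component
equations and the pointwise identity for `□_G`; Parts 3–4 run John's reduction backwards on a slab
(constraint propagation by characteristics, then the wave equation and the Cauchy data); Part 5
shows that on a tame background the coefficients are an admissible symmetric family in Friedrichs'
format with `C_c^∞` data; Part 6 assembles. Everything is proved; no named fact and no `sorry` is
introduced.

This module has 6 parts, in dependency order.

## Part 1. From the symmetrised system back to the `3 + 1` first-order system: `W = S V` solves `∂_t W = 𝔄ᵏ ∂_k W + 𝔅 W` iff `V` solves `A⁰ ∂_t V = Aᵏ ∂_k V + B V`; the component equations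

Continuation of `KerrSchildSymmHypCoefficients.lean`. For a generalised Kerr–Schild background `B`
and a field `W : ℝ⁴ → RVec` which at the point `x` is differentiable and satisfies the symmetrised
first-order system `∂_t W = ∑_k 𝔄ᵏ ∂_k W + 𝔅 W` (the format of Friedrichs 1954, §1, with the
coefficients `frakAOp`, `frakBOp`), the field `V = S⁻¹ W` satisfies at `x` the `3 + 1` system
`A⁰ ∂_t V = ∑_k Aᵏ ∂_k V + B V` (`a0Op_fderiv_unsymm_eq`) — by the product rule and
`S S⁻¹ = S⁻¹ S = 1` only, the coefficient `𝔅` having been defined for exactly this purpose — and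
hence, reading off components and inverting the spatial block `h` of `A⁰` with the slice metric,
its components `q⃗ = V_{inl}`, `q₀ = V_{inr 0}`, `u = V_{inr 1}` satisfy the three scalar equation
families of John's reduction (John, *PDE*, Ch. 5 §3, in lapse–shift form):

* `fderiv_qVar_zero_dir` — `∂_t q_i = ∂_i q₀ + βᵏ ∂_k q_i + (∂_i βᵐ) q_m`;
* `invLapseSq_mul_fderiv_q0` — `a ∂_t q₀ = a βᵏ ∂_k q₀ + h^{kj} ∂_k q_j + e⁰ q₀ + eʲ q_j`;
* `fderiv_uVar_zero_dir` — `∂_t u = q₀ + βʲ q_j`.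

Everything is proved; no named fact and no `sorry` is introduced.

## Part 2. The divergence-form wave operator in lapse–shift variables: the pointwise identity behind John's first-order reduction

For a generalised Kerr–Schild background `B` (`G = g⁻¹`, `a = −G⁰⁰`, `βᵏ = G^{0k}/a`,
`h^{jk} = G^{jk} + a βʲβᵏ`; `KerrSchildLapseShift.lean`) and a function `u` of class `C²` at `x`,
with the **momentum variable** `q₀ = ∂_t u − βᵏ ∂_k u` (a function near `x`) and `q_k = ∂_k u`,
the divergence-form wave operator `□_G u = ∑_μ ∂_μ (∑_ν G^{μν} ∂_ν u)` satisfies at `x`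

  `□_G u = −a (∂_t q₀ − βʲ ∂_j q₀) + ∑_{jk} h^{jk} ∂_j q_k + e⁰ q₀ + ∑_k eᵏ q_k`,

`e⁰ = ∑_μ ∂_μ G^{μ0}` (`divInvMetric 0`), `eᵏ = lowCoeff k` (`KerrSchildSymmHypCoefficients.lean`)
— `waveOperator_eq_lapseShift`. This is the computation behind the reduction of the second-order
equation `□_G u = 0` to the first-order system `A⁰ ∂_t V = Aᵏ ∂_k V + B V` for
`V = (q⃗, q₀, u)` (John, *PDE*, Ch. 5 §3, (3.2)–(3.4), in the lapse–shift form of the module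
docstring of `KerrSchildLapseShift.lean`): expand `□_G u = ∑ (∂_μ G^{μν}) ∂_ν u + ∑ G^{μν} ∂_μ∂_ν u`
(`KerrSchild.waveOperator_eq_sum_sum`), use `G⁰⁰ = −a`, `G^{0k} = a βᵏ`, `G^{jk} = h^{jk} − a βʲβᵏ`
and the symmetry of second derivatives. Only the pointwise values of `G`, `∂G`, `β`, `∂β` enter;
it is an algebraic identity.

Everything is proved; no named fact and no `sorry` is introduced.

## Part 3. Propagation of the constraints `q⃗ = ∇u` for classical solutions of the symmetrised first-order form of the wave equation on a Kerr–Schild background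

Continuation of Part 1 of this module. Let `B` be a generalised Kerr–Schild
background, `T > 0`, and let `W : ℝ⁴ → RVec` be smooth at the points of the open slab `{|t| < T}`,
solve there the symmetrised system `∂_t W = ∑_k 𝔄ᵏ ∂_k W + 𝔅 W`, and take on `{t = 0}` the
**Cauchy data of a pair `(ψ₀, ψ₁)`**: `W(0, y) = S(0, y) V₀(y)`,
`V₀ = (∇ψ₀, ψ₁ − βᵏ∂_kψ₀, ψ₀)` (`Background.dataW`; the structure `Background.IsSymmHypSol`). Then
the unsymmetrised variables `(q⃗, q₀, u) = S⁻¹ W` satisfy on the slab the component equations of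
Part 1 of this module, and the constraints of John's reduction propagate
(John, *PDE*, Ch. 5 §3; the lapse–shift form of the module docstring of
`KerrSchildLapseShift.lean`):

* `IsSymmHypSol.curl_eq_zero` — `ω_{kj} = ∂_k q_j − ∂_j q_k` vanishes on the slab: it vanishes at
  `t = 0` (`q⃗(0, ·) = ∇ψ₀`), and differentiating the `q⃗`-equations gives the linear transport
  system `∂_t ω_{kj} = βᵐ ∂_m ω_{kj} + (∂_kβᵐ) ω_{mj} + (∂_jβᵐ) ω_{km}`, to which the uniqueness
  theorem by characteristics (`E4.eq_zero_of_transport_of_data_zero`,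
  `SlabTransportUniqueness.lean`) applies;
* `IsSymmHypSol.qVar_eq_fderiv_uVar` — hence `∂_t (q_j − ∂_j u) = βᵏ ω_{kj} = 0`, and
  `q_j − ∂_j u`, vanishing at `t = 0`, vanishes on the slab (the same uniqueness theorem with zero
  drift): **`q⃗ = ∇u` on the slab**;
* `IsSymmHypSol.q0Var_eq` — and `q₀ = ∂_t u − βᵏ ∂_k u` on the slab (the `u`-equation).

The wave equation for `u` and the Cauchy data are derived from these in
Part 4 of this module. Everything is proved; no named fact and no `sorry` is
introduced.

## Part 4. From classical slab solutions of the symmetrised first-order system to smooth slab solutions of the wave equation with prescribed Cauchy data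

Conclusion of John's reduction (John, *PDE*, Ch. 5 §3) for the divergence-form wave operator of a
generalised Kerr–Schild background `B` (lapse–shift form; `KerrSchildSymmHypCoefficients.lean`,
`…Derivation.lean`, `…Identity.lean`, `…Constraints.lean`): if `W` is a classical solution of the
symmetrised system `∂_t W = ∑_k 𝔄ᵏ ∂_k W + 𝔅 W` on the open slab `{|t| < T}` with the Cauchy data
`W₀ = S V₀`, `V₀ = (∇ψ₀, ψ₁ − βᵏ∂_kψ₀, ψ₀)` of a pair `ψ₀, ψ₁ ∈ C^∞(ℝ³)` (`Background.IsSymmHypSol`),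
then its last component `u = W_u` is `C^∞` at the points of the slab, solves
`□_G u = ∑_μ ∂_μ (G^{μν} ∂_ν u) = 0` there (`IsSymmHypSol.waveOperator_uVar`: the `q₀`-equation,
the constraints `q⃗ = ∇u`, `q₀ = ∂_t u − βᵏ∂_k u` of `…Constraints.lean` and the pointwise identity
`waveOperator_eq_lapseShift` of `…Identity.lean`), and has the coordinate Cauchy data
`u(0, y) = ψ₀(y)`, `∂_t u(0, y) = ψ₁(y)` (`IsSymmHypSol.fderiv_uVar_zero_data`).

`Background.exists_slabWave_of_isSymmHypSol` packages this in the format of the hypothesis of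
`KerrSchild.waveCauchyProblem_of_slabSolutions` (`KerrSchildWaveCauchyAssembly.lean`): so the named
fact `KerrSchild.waveCauchyProblem` is reduced to the existence of classical slab solutions of
symmetric hyperbolic systems with the coefficients `frakAOp`, `frakBOp` (smooth, `𝔄ᵏ` symmetric,
constant outside a compact set of every slab of a tame background) and `C_c^∞` data — Friedrichs'
theorem (Friedrichs 1954). That last step is Part 6 of this module.

Everything is proved; no named fact and no `sorry` is introduced.

## Part 5. The symmetrised first-order form of the wave equation on a tame Kerr–Schild background as a symmetric hyperbolic system in Friedrichs' format: admissible coefficients and `C_c^∞` data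

The coefficient operators `𝔄ᵏ`, `𝔅` of the symmetrised system (`Background.frakAOp`,
`Background.frakBOp`, `KerrSchildSymmHypCoefficients.lean`), fields over `ℝ⁴`, are here transported
to the time-dependent format `Aⱼ(t, y) = 𝔄ʲ(t, y)`, `B(t, y) = 𝔅(t, y)` on `ℝ × ℝ³` of the tree's
theory of linear symmetric hyperbolic systems `∂ₜU = ∑ⱼ Aⱼ ∂ⱼU + B U` (Friedrichs 1954;
`Literature.Analysis.PDE.foOp`, `IsSymmCoeff`, `IsSymmCoeffFamily` of
`SymmetricHyperbolicEnergy.lean` / `SymmetricHyperbolicRegularised.lean`), and shown to be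
admissible on every **tame** background (`Background.IsTame`: on every slab the profile vanishes
outside a bounded cylinder, so that there `𝔄ᵏ`, `𝔅` are the constant Minkowski coefficients,
`frakAOp_of_eventuallyEq`, `frakBOp_of_eventuallyEq`):

* `Background.coeffA`, `Background.coeffB` — the transported coefficients; jointly `C^∞`
  (`contDiff_coeffA_uncurry`, `contDiff_coeffB_uncurry`);
* `Background.IsTame.isSymmCoeffFamily` — **admissibility**: at each time the frozen coefficients are
  smooth, `𝔄ᵏ` is symmetric, and all spatial word derivatives are bounded uniformly on compact time
  intervals (a word derivative of a slice of a smooth field on `ℝ⁴` is the corresponding iterated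
  partial derivative of the field, `cwd_slice_eq`; it is continuous, hence bounded on a compact
  cylinder, and constant outside it); Lipschitz in time by the mean value theorem;
* `Background.contDiff_dataW`, `Background.hasCompactSupport_dataW` — the Cauchy data
  `W₀ = S(0, ·) (∇ψ₀, ψ₁ − βᵏ∂_kψ₀, ψ₀)` of `C_c^∞` data `ψ₀, ψ₁` are `C_c^∞`.

Everything is proved; no named fact and no `sorry` is introduced.

## Part 6. `KerrSchild.waveCauchyProblem` from the existence of classical solutions of linear symmetric hyperbolic systems

**Theorem** (`KerrSchild.waveCauchyProblem_of_symmHyperbolic`). Suppose that every linear symmetric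
hyperbolic system `∂ₜU = ∑ⱼ Aⱼ(t, y) ∂ⱼU + B(t, y) U` on `ℝ × ℝ³` with values in
`RVec = EuclideanSpace ℝ (Fin 3 ⊕ Fin 2)`, whose coefficients are an admissible symmetric family
(`Literature.Analysis.PDE.IsSymmCoeffFamily`: smooth, `Aⱼ` symmetric, all spatial derivatives
bounded on compact time intervals, Lipschitz in time), jointly `C^∞`, and with all spatial word
derivatives Lipschitz in time uniformly in space on compact time intervals, admits for all `C_c^∞`
data `U₀` and every `T > 0` a classical solution on the slab `{|t| < T}` — `U(0) = U₀`,
`(t, y) ↦ U(t, y)` of class `C^∞` at the points of the slab, and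
`∂ₜU(t, y) = (∑ⱼ Aⱼ ∂ⱼU + B U)(t, y)` (`Literature.Analysis.PDE.foOp`) there. Then the named fact
`KerrSchild.waveCauchyProblem` (`KerrSchildWaveCauchyProblem.lean`: the global Cauchy problem with
domain of dependence for `□_g u = 0` on every generalised Kerr–Schild background over `ℝ⁴`,
Bär–Ginoux–Pfäffle 2007, Thm. 3.2.11 in the chart) holds.

The hypothesis is exactly the conclusion of Friedrichs' existence theorem for linear symmetric
hyperbolic systems (Friedrichs 1954, Thms. of §§6–8; Lax 2006, Ch. 6; Taylor, *PDE III*, Ch. 16,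
§1, Prop. 1.4/Thm. 1.2), whose energy-method proof is the content of the tree's
`Literature/Analysis/PDE/SymmetricHyperbolic*.lean`; it is the single remaining analytic input of
`KerrSchild.waveCauchyProblem`, and is taken here as an explicit hypothesis (not vendored as a
named fact: D-0026).

Proof: `KerrSchild.waveCauchyProblem_of_slabSolutions` (`KerrSchildWaveCauchyAssembly.lean`: slab
solutions on tame backgrounds ⟹ the fact, by uniqueness, gluing, domain of dependence and
localisation of the coefficients) reduces to smooth slab solutions of the wave equation on **tame**
backgrounds with prescribed coordinate Cauchy data; on a tame background the coefficients
`𝔄ᵏ, 𝔅` of the symmetrised first-order (lapse–shift) form of the wave equation are an admissible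
symmetric family and the data `W₀ = S(0,·)(∇ψ₀, ψ₁ − βᵏ∂_kψ₀, ψ₀)` are `C_c^∞`
(Part 5 of this module); the hypothesis gives a classical slab solution `U`, whose
transport `W(x) = U(x⁰, x⃗)` to `ℝ⁴` is a classical slab solution of `∂_t W = 𝔄ᵏ∂_kW + 𝔅W` with
these data (`Background.IsSymmHypSol`), and John's reduction run backwards
(`Background.exists_slabWave_of_isSymmHypSol`, Part 4 of this module: constraint
propagation by characteristics, the `q₀`-equation and the pointwise identity) produces the smooth
slab solution `u = W_u` of `□_G u = 0` with data `(ψ₀, ψ₁)`.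

Everything is proved; no named fact and no `sorry` is introduced.

## References

* F. John, *Partial differential equations*, 4th ed., Springer 1982, Ch. 5, §3. [John1982]
* K. O. Friedrichs, Comm. Pure Appl. Math. 7 (1954) 345–392, §1. [Friedrichs1954]
* Y. Choquet-Bruhat, S. Cotsakis, J. Geom. Phys. 43 (2002) 345–350, §2, (2.1). [ChoquetbruhatCotsakis2002]
* L. Hörmander, *Lectures on nonlinear hyperbolic differential equations*, Springer 1997, §6.3,
  (6.3.15) (bounded derivatives of the coefficients on slabs). [Hormander1997]
* C. Bär, N. Ginoux, F. Pfäffle, *Wave equations on Lorentzian manifolds and quantization*, EMS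
  2007, Thm. 3.2.11. [BarGinouxPfaffle2007]
-/

noncomputable section

open Set Filter
open scoped ContDiff Topology

namespace Literature.Geometry.Lorentzian

namespace KerrSchild

namespace Background

variable (B : Background)

/-! ### Derivatives of coordinates of vector fields -/

/-- The derivative of a coordinate of an `RVec`-valued field is the coordinate of the derivative.
[folklore] -/
theorem fderiv_coord_apply {V : E4 → RVec} {x : E4} (hV : DifferentiableAt ℝ V x) (I : RIdx)
    (v : E4) : fderiv ℝ (fun y ↦ V y I) x v = fderiv ℝ V x v I := by
  have h := ((EuclideanSpace.proj (𝕜 := ℝ) I).hasFDerivAt.comp x hV.hasFDerivAt).fderiv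
  rw [show (fun y ↦ V y I) = (EuclideanSpace.proj (𝕜 := ℝ) I) ∘ V from rfl, h]
  rfl

/-- A coordinate of a differentiable `RVec`-valued field is differentiable. [folklore] -/
theorem differentiableAt_coord {V : E4 → RVec} {x : E4} (hV : DifferentiableAt ℝ V x) (I : RIdx) :
    DifferentiableAt ℝ (fun y ↦ V y I) x :=
  ((EuclideanSpace.proj (𝕜 := ℝ) I).differentiableAt).comp x hV

/-! ### The unsymmetrised field `V = S⁻¹ W` and its derivative -/

/-- The **unsymmetrised variables** `V = S⁻¹ W = (q⃗, q₀, u)` of a field `W` of symmetrised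
variables. [cite: John1982, Ch. 5 §3] -/
def unsymm (W : E4 → RVec) (y : E4) : RVec := B.sInvOp y (W y)

/-- `W = S V`. [cite: John1982, Ch. 5 §3] -/
theorem sOp_unsymm (W : E4 → RVec) (y : E4) : B.sOp y (B.unsymm W y) = W y :=
  B.sOp_sInvOp_apply y (W y)

/-- **Product rule for `V = S⁻¹ W`**: `∂_v V = S⁻¹ ∂_v W + (∂_v S⁻¹) W`. [folklore] -/
theorem hasFDerivAt_unsymm {W : E4 → RVec} {x : E4} (hW : DifferentiableAt ℝ W x) :
    HasFDerivAt (B.unsymm W)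
      ((B.sInvOp x).comp (fderiv ℝ W x) + (fderiv ℝ B.sInvOp x).flip (W x)) x :=
  (B.contDiff_sInvOp.differentiable (by simp)).differentiableAt.hasFDerivAt.clm_apply hW.hasFDerivAt

/-- `V = S⁻¹ W` is differentiable where `W` is. [folklore] -/
theorem differentiableAt_unsymm {W : E4 → RVec} {x : E4} (hW : DifferentiableAt ℝ W x) :
    DifferentiableAt ℝ (B.unsymm W) x :=
  (B.hasFDerivAt_unsymm hW).differentiableAt

/-- `∂_v V = S⁻¹ (∂_v W) + (∂_v S⁻¹) W`, applied form. [folklore] -/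
theorem fderiv_unsymm_apply {W : E4 → RVec} {x : E4} (hW : DifferentiableAt ℝ W x) (v : E4) :
    fderiv ℝ (B.unsymm W) x v = B.sInvOp x (fderiv ℝ W x v) + fderiv ℝ B.sInvOp x v (W x) := by
  rw [(B.hasFDerivAt_unsymm hW).fderiv]
  rfl

/-- `∂_v W = S (∂_v V) + (∂_v S) V` (product rule for `W = S V`). [folklore] -/
theorem fderiv_eq_sOp_fderiv_unsymm {W : E4 → RVec} {x : E4} (hW : DifferentiableAt ℝ W x) (v : E4) :
    fderiv ℝ W x v =
      B.sOp x (fderiv ℝ (B.unsymm W) x v) + fderiv ℝ B.sOp x v (B.unsymm W x) := by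
  have hS : DifferentiableAt ℝ B.sOp x := (B.contDiff_sOp.differentiable (by simp)).differentiableAt
  have h := (hS.hasFDerivAt.clm_apply (B.hasFDerivAt_unsymm hW)).fderiv
  have hfun : (fun y ↦ B.sOp y (B.unsymm W y)) = W := funext fun y ↦ B.sOp_unsymm W y
  rw [hfun] at h
  rw [h, (B.hasFDerivAt_unsymm hW).fderiv]
  rfl

/-! ### The `3 + 1` system from the symmetrised system -/

/-- **`V = S⁻¹ W` solves `A⁰ ∂_t V = ∑_k Aᵏ ∂_k V + B V` at `x` when `W` solves the symmetrised
system `∂_t W = ∑_k 𝔄ᵏ ∂_k W + 𝔅 W` at `x`** (`𝔄ᵏ = S⁻¹AᵏS⁻¹`,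
`𝔅 = S⁻¹BS⁻¹ − S ∂_tS⁻¹ − ∑_k 𝔄ᵏ (∂_kS) S⁻¹`, `A⁰ = S S`; product rule and `S S⁻¹ = S⁻¹ S = 1`).
[cite: John1982, Ch. 5 §3] -/
theorem a0Op_fderiv_unsymm_eq {W : E4 → RVec} {x : E4} (hW : DifferentiableAt ℝ W x)
    (hsys : fderiv ℝ W x (E4.basisVector 0) =
      ∑ k : Fin 3, B.frakAOp k x (fderiv ℝ W x (E4.basisVector k.succ)) + B.frakBOp x (W x)) :
    B.a0Op x (fderiv ℝ (B.unsymm W) x (E4.basisVector 0)) =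
      ∑ k : Fin 3, B.akOp k x (fderiv ℝ (B.unsymm W) x (E4.basisVector k.succ)) +
        B.bOp x (B.unsymm W x) := by
  -- shorthands
  set S := B.sOp x with hSdef
  set Si := B.sInvOp x with hSidef
  set v := B.unsymm W x with hvdef
  set dV : Fin 4 → RVec := fun μ ↦ fderiv ℝ (B.unsymm W) x (E4.basisVector μ) with hdV
  set dW : Fin 4 → RVec := fun μ ↦ fderiv ℝ W x (E4.basisVector μ) with hdW
  set dS : Fin 3 → RVec →L[ℝ] RVec := fun k ↦ fderiv ℝ B.sOp x (E4.basisVector k.succ) with hdS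
  set dSi0 : RVec →L[ℝ] RVec := fderiv ℝ B.sInvOp x (E4.basisVector 0) with hdSi0
  have hSSi : ∀ u, S (Si u) = u := B.sOp_sInvOp_apply x
  have hSiS : ∀ u, Si (S u) = u := B.sInvOp_sOp_apply x
  have hvW : Si (W x) = v := rfl
  -- (f1) `∂_t V = S⁻¹ ∂_t W + (∂_t S⁻¹) W`
  have e1 : dV 0 = Si (dW 0) + dSi0 (W x) := B.fderiv_unsymm_apply hW _
  -- (f2) `S⁻¹ ∂_k W = ∂_k V + S⁻¹ (∂_k S) V`
  have e2 : ∀ k : Fin 3, Si (dW k.succ) = dV k.succ + Si (dS k v) := fun k ↦ by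
    simp only [hdW, hdV, hdS]
    rw [B.fderiv_eq_sOp_fderiv_unsymm hW, map_add, hSiS]
  -- the symmetrised system, unfolded
  have e3 : dW 0 = ∑ k : Fin 3, (Si (B.akOp k x (dV k.succ)) + Si (B.akOp k x (Si (dS k v)))) +
      (Si (B.bOp x v) - S (dSi0 (W x)) - ∑ k : Fin 3, Si (B.akOp k x (Si (dS k v)))) := by
    have h := hsys
    simp only [frakBOp, frakAOp, sub_apply, FunLike.coe_sum, Finset.sum_apply,
      mul_apply_eq_comp] at h
    rw [hdW]
    simp only
    rw [h]
    congr 1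
    refine Finset.sum_congr rfl fun k _ ↦ ?_
    rw [← hSidef, e2 k, map_add, map_add]
  -- assemble
  rw [← B.sOp_sOp_apply]
  change S (S (dV 0)) = ∑ k : Fin 3, B.akOp k x (dV k.succ) + B.bOp x v
  rw [e1, map_add, hSSi, e3]
  simp only [map_add, map_sub, map_sum, hSSi, Finset.sum_add_distrib]
  abel

/-! ### The component equations -/

section Components

variable {W : E4 → RVec} {x : E4}

/-- The spatial variables `q_i = V_{inl i}`. [cite: John1982, Ch. 5 §3] -/
def qVar (W : E4 → RVec) (i : Fin 3) (y : E4) : ℝ := B.unsymm W y (Sum.inl i)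

/-- The variable `q₀ = V_{inr 0}`. [cite: John1982, Ch. 5 §3] -/
def q0Var (W : E4 → RVec) (y : E4) : ℝ := B.unsymm W y (Sum.inr 0)

/-- The variable `u = V_{inr 1}` (`= W_{inr 1}`). [cite: John1982, Ch. 5 §3] -/
def uVar (W : E4 → RVec) (y : E4) : ℝ := B.unsymm W y (Sum.inr 1)

/-- `u = W_{inr 1}` (the symmetriser does not touch the last variable). [cite: John1982, Ch. 5 §3] -/
theorem uVar_eq (W : E4 → RVec) (y : E4) : B.uVar W y = W y (Sum.inr 1) :=
  B.sInvOp_apply_inr_one y (W y)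

/-- **The `q₀`-equation**: `a ∂_t q₀ = ∑_k (a βᵏ ∂_k q₀ + ∑_j h^{kj} ∂_k q_j) + e⁰ q₀ + ∑_j eʲ q_j`.
[cite: John1982, Ch. 5 §3] -/
theorem invLapseSq_mul_fderiv_q0 (hW : DifferentiableAt ℝ W x)
    (hsys : fderiv ℝ W x (E4.basisVector 0) =
      ∑ k : Fin 3, B.frakAOp k x (fderiv ℝ W x (E4.basisVector k.succ)) + B.frakBOp x (W x)) :
    B.invLapseSq x * fderiv ℝ (B.q0Var W) x (E4.basisVector 0) =
      ∑ k : Fin 3, (B.invLapseSq x * B.shift x k * fderiv ℝ (B.q0Var W) x (E4.basisVector k.succ) +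
        ∑ j : Fin 3, B.sliceInvMetric x k j * fderiv ℝ (B.qVar W j) x (E4.basisVector k.succ)) +
      B.divInvMetric x 0 * B.q0Var W x + ∑ j : Fin 3, B.lowCoeff x j * B.qVar W j x := by
  have hV := B.differentiableAt_unsymm hW
  have h := congrArg (fun z : RVec ↦ z (Sum.inr 0)) (B.a0Op_fderiv_unsymm_eq hW hsys)
  simp only at h
  rw [B.a0Op_apply_inr_zero, PiLp.add_apply, WithLp.ofLp_sum, Finset.sum_apply, B.bOp_apply_inr_zero] at h
  simp only [B.akOp_apply_inr_zero] at h
  unfold q0Var qVar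
  simp only [fderiv_coord_apply hV]
  rw [h]
  simp only [Finset.sum_add_distrib]
  ring

/-- **The `u`-equation**: `∂_t u = q₀ + ∑_j βʲ q_j`. [cite: John1982, Ch. 5 §3] -/
theorem fderiv_uVar_zero_dir (hW : DifferentiableAt ℝ W x)
    (hsys : fderiv ℝ W x (E4.basisVector 0) =
      ∑ k : Fin 3, B.frakAOp k x (fderiv ℝ W x (E4.basisVector k.succ)) + B.frakBOp x (W x)) :
    fderiv ℝ (B.uVar W) x (E4.basisVector 0) = B.q0Var W x + ∑ j : Fin 3, B.shift x j * B.qVar W j x := by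
  have hV := B.differentiableAt_unsymm hW
  have h := congrArg (fun z : RVec ↦ z (Sum.inr 1)) (B.a0Op_fderiv_unsymm_eq hW hsys)
  simp only at h
  rw [B.a0Op_apply_inr_one, PiLp.add_apply, WithLp.ofLp_sum, Finset.sum_apply, B.bOp_apply_inr_one] at h
  simp only [B.akOp_apply_inr_one, Finset.sum_const_zero, zero_add] at h
  unfold uVar q0Var qVar
  simp only [fderiv_coord_apply hV]
  rw [h, add_comm]

/-- The spatial block of the `3 + 1` system, before inversion of `h`:
`∑_j h_{ij} ∂_t q_j = ∑_k (βᵏ ∑_j h_{ij} ∂_k q_j + h_{ik} ∂_k q₀) + ∑_m (∑_j h_{ij} ∂_jβᵐ) q_m`.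
[cite: John1982, Ch. 5 §3] -/
theorem sum_sliceInvMetric_mul_fderiv_qVar (hW : DifferentiableAt ℝ W x)
    (hsys : fderiv ℝ W x (E4.basisVector 0) =
      ∑ k : Fin 3, B.frakAOp k x (fderiv ℝ W x (E4.basisVector k.succ)) + B.frakBOp x (W x))
    (i : Fin 3) :
    ∑ j : Fin 3, B.sliceInvMetric x i j * fderiv ℝ (B.qVar W j) x (E4.basisVector 0) =
      ∑ k : Fin 3, (B.shift x k * ∑ j : Fin 3, B.sliceInvMetric x i j *
          fderiv ℝ (B.qVar W j) x (E4.basisVector k.succ) +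
        B.sliceInvMetric x i k * fderiv ℝ (B.q0Var W) x (E4.basisVector k.succ)) +
      ∑ m : Fin 3, (∑ j : Fin 3, B.sliceInvMetric x i j * B.dShift x j m) * B.qVar W m x := by
  have hV := B.differentiableAt_unsymm hW
  have h := congrArg (fun z : RVec ↦ z (Sum.inl i)) (B.a0Op_fderiv_unsymm_eq hW hsys)
  simp only at h
  rw [B.a0Op_apply_inl, PiLp.add_apply, WithLp.ofLp_sum, Finset.sum_apply, B.bOp_apply_inl] at h
  simp only [B.akOp_apply_inl] at h
  unfold q0Var qVar
  simp only [fderiv_coord_apply hV]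
  exact h

/-- **The `q⃗`-equations**: `∂_t q_i = ∂_i q₀ + ∑_k βᵏ ∂_k q_i + ∑_m (∂_i βᵐ) q_m` (the spatial
block of the `3 + 1` system, after multiplication by the slice metric `h⁻¹`).
[cite: John1982, Ch. 5 §3] -/
theorem fderiv_qVar_zero_dir (hW : DifferentiableAt ℝ W x)
    (hsys : fderiv ℝ W x (E4.basisVector 0) =
      ∑ k : Fin 3, B.frakAOp k x (fderiv ℝ W x (E4.basisVector k.succ)) + B.frakBOp x (W x))
    (i : Fin 3) :
    fderiv ℝ (B.qVar W i) x (E4.basisVector 0) =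
      fderiv ℝ (B.q0Var W) x (E4.basisVector i.succ) +
        ∑ k : Fin 3, B.shift x k * fderiv ℝ (B.qVar W i) x (E4.basisVector k.succ) +
        ∑ m : Fin 3, B.dShift x i m * B.qVar W m x := by
  -- abbreviations for the unknowns `X_j = ∂_t q_j` and the claimed values `Y_j`
  set X : Fin 3 → ℝ := fun j ↦ fderiv ℝ (B.qVar W j) x (E4.basisVector 0) with hX
  set Y : Fin 3 → ℝ := fun j ↦ fderiv ℝ (B.q0Var W) x (E4.basisVector j.succ) +
      ∑ k : Fin 3, B.shift x k * fderiv ℝ (B.qVar W j) x (E4.basisVector k.succ) +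
      ∑ m : Fin 3, B.dShift x j m * B.qVar W m x with hY
  -- the block equation says `h X = h Y`
  have hblock : ∀ l : Fin 3, ∑ j : Fin 3, B.sliceInvMetric x l j * X j =
      ∑ j : Fin 3, B.sliceInvMetric x l j * Y j := by
    intro l
    rw [B.sum_sliceInvMetric_mul_fderiv_qVar hW hsys l]
    have p2 : ∑ k : Fin 3, B.shift x k * ∑ j : Fin 3, B.sliceInvMetric x l j *
        fderiv ℝ (B.qVar W j) x (E4.basisVector k.succ) =
        ∑ j : Fin 3, B.sliceInvMetric x l j * ∑ k : Fin 3, B.shift x k *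
          fderiv ℝ (B.qVar W j) x (E4.basisVector k.succ) := by
      simp_rw [Finset.mul_sum]
      rw [Finset.sum_comm]
      exact Finset.sum_congr rfl fun j _ ↦ Finset.sum_congr rfl fun k _ ↦ by ring
    have p3 : ∑ m : Fin 3, (∑ j : Fin 3, B.sliceInvMetric x l j * B.dShift x j m) * B.qVar W m x =
        ∑ j : Fin 3, B.sliceInvMetric x l j * ∑ m : Fin 3, B.dShift x j m * B.qVar W m x := by
      simp_rw [Finset.mul_sum, Finset.sum_mul]
      rw [Finset.sum_comm]
      exact Finset.sum_congr rfl fun j _ ↦ Finset.sum_congr rfl fun m _ ↦ by ring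
    have p1 : ∑ k : Fin 3, (B.shift x k * ∑ j : Fin 3, B.sliceInvMetric x l j *
          fderiv ℝ (B.qVar W j) x (E4.basisVector k.succ) +
        B.sliceInvMetric x l k * fderiv ℝ (B.q0Var W) x (E4.basisVector k.succ)) =
        ∑ k : Fin 3, B.shift x k * ∑ j : Fin 3, B.sliceInvMetric x l j *
          fderiv ℝ (B.qVar W j) x (E4.basisVector k.succ) +
        ∑ k : Fin 3, B.sliceInvMetric x l k * fderiv ℝ (B.q0Var W) x (E4.basisVector k.succ) :=
      Finset.sum_add_distrib
    rw [p1, p2, p3]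
    simp only [hY, mul_add, Finset.sum_add_distrib]
    ring
  -- invert `h` with the slice metric
  have hinv : ∀ Z : Fin 3 → ℝ, ∑ l : Fin 3, B.sliceMetric x i l * ∑ j : Fin 3, B.sliceInvMetric x l j * Z j = Z i := by
    intro Z
    simp_rw [Finset.mul_sum, ← mul_assoc]
    rw [Finset.sum_comm]
    simp_rw [← Finset.sum_mul, B.sum_sliceMetric_mul_sliceInvMetric]
    simp
  have hXY : X i = Y i := by
    rw [← hinv X, ← hinv Y]
    exact Finset.sum_congr rfl fun l _ ↦ by rw [hblock l]
  simpa [hX, hY] using hXY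

end Components

end Background

end KerrSchild

end Literature.Geometry.Lorentzian

end

noncomputable section

open Set Filter
open scoped ContDiff Topology

namespace Literature.Geometry.Lorentzian

namespace KerrSchild

namespace Background

variable (B : Background)

/-! ### The inverse metric through lapse, shift and slice metric -/

/-- `G⁰⁰ = −a`. [cite: ChoquetbruhatCotsakis2002, §2 (2.2)] -/
theorem inverseMetric_zero_zero_eq (x : E4) : B.inverseMetric x 0 0 = -B.invLapseSq x := by
  rw [B.invLapseSq_eq_neg_inverseMetric]; ring

/-- `G^{0k} = a βᵏ`. [cite: ChoquetbruhatCotsakis2002, §2 (2.1)] -/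
theorem inverseMetric_zero_succ_eq (x : E4) (k : Fin 3) :
    B.inverseMetric x 0 k.succ = B.invLapseSq x * B.shift x k :=
  (B.invLapseSq_mul_shift x k).symm

/-- `G^{k0} = a βᵏ`. [cite: ChoquetbruhatCotsakis2002, §2 (2.1)] -/
theorem inverseMetric_succ_zero_eq (x : E4) (k : Fin 3) :
    B.inverseMetric x k.succ 0 = B.invLapseSq x * B.shift x k := by
  rw [← B.inverseMetric_zero_succ_eq]
  exact KerrSchild.inverseMetric_symm _ _ x _ _

/-- `G^{jk} = h^{jk} − a βʲ βᵏ`. [cite: ChoquetbruhatCotsakis2002, §2 (2.1)] -/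
theorem inverseMetric_succ_succ_eq (x : E4) (j k : Fin 3) :
    B.inverseMetric x j.succ k.succ =
      B.sliceInvMetric x j k - B.invLapseSq x * B.shift x j * B.shift x k := by
  rw [sliceInvMetric]; ring

/-! ### Derivatives of the momentum variable -/

/-- **The derivative of the momentum variable**: for `u ∈ C²` at `x` and
`q₀ = ∂_t u − ∑_k βᵏ ∂_k u`, `∂_v q₀ (x) = ∂_v∂_t u − ∑_k ((∂_v βᵏ) ∂_k u + βᵏ ∂_v∂_k u)`.
[cite: John1982, Ch. 5 §3] -/
theorem fderiv_momentum_apply {u : E4 → ℝ} {x : E4} (hu : ContDiffAt ℝ 2 u x) (v : E4) :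
    fderiv ℝ (fun y ↦ fderiv ℝ u y (E4.basisVector 0) -
        ∑ k : Fin 3, B.shift y k * fderiv ℝ u y (E4.basisVector k.succ)) x v =
      fderiv ℝ (fderiv ℝ u) x v (E4.basisVector 0) -
        ∑ k : Fin 3, (fderiv ℝ (fun y ↦ B.shift y k) x v * fderiv ℝ u x (E4.basisVector k.succ) +
          B.shift x k * fderiv ℝ (fderiv ℝ u) x v (E4.basisVector k.succ)) := by
  have hu2 : DifferentiableAt ℝ (fderiv ℝ u) x :=
    (hu.fderiv_right (m := 1) le_rfl).differentiableAt one_ne_zero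
  have hdP : ∀ κ : Fin 4, HasFDerivAt (fun y ↦ fderiv ℝ u y (E4.basisVector κ))
      ((fderiv ℝ (fderiv ℝ u) x).flip (E4.basisVector κ)) x := by
    intro κ
    have := hu2.hasFDerivAt.clm_apply (hasFDerivAt_const (E4.basisVector κ) x)
    simpa using this
  have hβ : ∀ k : Fin 3, HasFDerivAt (fun y ↦ B.shift y k) (fderiv ℝ (fun y ↦ B.shift y k) x) x :=
    fun k ↦ ((B.contDiff_shift k).differentiable (by simp)).differentiableAt.hasFDerivAt
  have h : HasFDerivAt (fun y ↦ fderiv ℝ u y (E4.basisVector 0) -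
      ∑ k : Fin 3, B.shift y k * fderiv ℝ u y (E4.basisVector k.succ))
      ((fderiv ℝ (fderiv ℝ u) x).flip (E4.basisVector 0) -
        ∑ k : Fin 3, (B.shift x k • (fderiv ℝ (fderiv ℝ u) x).flip (E4.basisVector k.succ) +
          fderiv ℝ u x (E4.basisVector k.succ) • fderiv ℝ (fun y ↦ B.shift y k) x)) x :=
    (hdP 0).sub (HasFDerivAt.fun_sum fun k _ ↦ (hβ k).mul (hdP k.succ))
  rw [h.fderiv]
  simp only [sub_apply, FunLike.coe_sum, Finset.sum_apply, add_apply, smul_apply, smul_eq_mul,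
    ContinuousLinearMap.flip_apply]
  congr 1
  exact Finset.sum_congr rfl fun k _ ↦ by ring

/-! ### The identity -/

/-- **The divergence-form wave operator in lapse–shift variables.** For `u ∈ C²` at `x`, with the
momentum variable `q₀ = ∂_t u − βᵏ ∂_k u` and `q_k = ∂_k u`:
`□_G u (x) = −a (∂_t q₀ − βʲ ∂_j q₀) + ∑_{jk} h^{jk} ∂_j∂_k u + e⁰ q₀ + ∑_k eᵏ ∂_k u` at `x`, where
`e⁰ = ∑_μ ∂_μ G^{μ0}` and `eᵏ = ∑_μ ∂_μ G^{μk} + e⁰ βᵏ − a (∂_t βᵏ − βʲ ∂_j βᵏ)`. This is the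
pointwise identity `G^{μν}∂_μ∂_ν u = −a (∂_t − βʲ∂_j) q₀ + h^{jk}∂_j q_k − a(∂_tβᵏ − βʲ∂_jβᵏ) q_k`
plus the first-order terms of the divergence form (John's reduction, lapse–shift form).
[cite: John1982, Ch. 5 §3 (3.2)–(3.4)] -/
theorem waveOperator_eq_lapseShift_explicit {u : E4 → ℝ} {x : E4} (hu : ContDiffAt ℝ 2 u x) :
    waveOperator B.inverseMetric u x =
      -B.invLapseSq x * (fderiv ℝ (fun y ↦ fderiv ℝ u y (E4.basisVector 0) -
            ∑ k : Fin 3, B.shift y k * fderiv ℝ u y (E4.basisVector k.succ)) x (E4.basisVector 0) -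
          ∑ j : Fin 3, B.shift x j * fderiv ℝ (fun y ↦ fderiv ℝ u y (E4.basisVector 0) -
            ∑ k : Fin 3, B.shift y k * fderiv ℝ u y (E4.basisVector k.succ)) x (E4.basisVector j.succ)) +
        ∑ j : Fin 3, ∑ k : Fin 3, B.sliceInvMetric x j k *
          fderiv ℝ (fderiv ℝ u) x (E4.basisVector j.succ) (E4.basisVector k.succ) +
        B.divInvMetric x 0 * (fderiv ℝ u x (E4.basisVector 0) -
            ∑ k : Fin 3, B.shift x k * fderiv ℝ u x (E4.basisVector k.succ)) +
        ∑ k : Fin 3, B.lowCoeff x k * fderiv ℝ u x (E4.basisVector k.succ) := by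
  have hG : ∀ μ ν, DifferentiableAt ℝ (fun y ↦ B.inverseMetric y μ ν) x := fun μ ν ↦
    ((B.contDiff_inverseMetric μ ν).differentiable (by simp)).differentiableAt
  have hsymm : IsSymmSndFDerivAt ℝ u x := hu.isSymmSndFDerivAt (by simp)
  -- the divergence-form operator expanded, with the first-order part through `divInvMetric`
  have hW : waveOperator B.inverseMetric u x =
      ∑ ν, B.divInvMetric x ν * fderiv ℝ u x (E4.basisVector ν) +
        ∑ μ, ∑ ν, B.inverseMetric x μ ν *
          fderiv ℝ (fderiv ℝ u) x (E4.basisVector μ) (E4.basisVector ν) := by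
    rw [waveOperator_eq_sum_sum hG hu]
    simp only [Finset.sum_add_distrib, divInvMetric, Finset.sum_mul]
    congr 1
    exact Finset.sum_comm
  rw [hW, B.fderiv_momentum_apply hu]
  simp only [B.fderiv_momentum_apply hu]
  -- abbreviations for the second derivatives and the derivatives of the shift
  set U : Fin 4 → Fin 4 → ℝ := fun μ ν ↦
    fderiv ℝ (fderiv ℝ u) x (E4.basisVector μ) (E4.basisVector ν) with hU
  set du : Fin 4 → ℝ := fun ν ↦ fderiv ℝ u x (E4.basisVector ν) with hdu
  set dβ : Fin 4 → Fin 3 → ℝ := fun μ k ↦ fderiv ℝ (fun y ↦ B.shift y k) x (E4.basisVector μ)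
    with hdβ
  have hUs : ∀ μ ν, U μ ν = U ν μ := fun μ ν ↦ hsymm _ _
  -- everything in terms of the atoms
  simp only [lowCoeff, dtShift, dShift]
  change ∑ ν, B.divInvMetric x ν * du ν + ∑ μ, ∑ ν, B.inverseMetric x μ ν * U μ ν =
    -B.invLapseSq x * (U 0 0 - ∑ k : Fin 3, (dβ 0 k * du k.succ + B.shift x k * U 0 k.succ) -
        ∑ j : Fin 3, B.shift x j * (U j.succ 0 -
          ∑ k : Fin 3, (dβ j.succ k * du k.succ + B.shift x k * U j.succ k.succ))) +
      ∑ j : Fin 3, ∑ k : Fin 3, B.sliceInvMetric x j k * U j.succ k.succ +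
      B.divInvMetric x 0 * (du 0 - ∑ k : Fin 3, B.shift x k * du k.succ) +
      ∑ k : Fin 3, (B.divInvMetric x k.succ + B.divInvMetric x 0 * B.shift x k -
        B.invLapseSq x * (dβ 0 k - ∑ j : Fin 3, B.shift x j * dβ j.succ k)) * du k.succ
  -- expand the sums
  simp only [Fin.sum_univ_four, Fin.sum_univ_three, Fin.succ_zero_eq_one, Fin.succ_one_eq_two,
    show (2 : Fin 3).succ = (3 : Fin 4) from rfl]
  -- substitute the lapse–shift form of `G` (literal indices)
  have g00 : B.inverseMetric x 0 0 = -B.invLapseSq x := B.inverseMetric_zero_zero_eq x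
  have g01 : B.inverseMetric x 0 1 = B.invLapseSq x * B.shift x 0 := B.inverseMetric_zero_succ_eq x 0
  have g02 : B.inverseMetric x 0 2 = B.invLapseSq x * B.shift x 1 := B.inverseMetric_zero_succ_eq x 1
  have g03 : B.inverseMetric x 0 3 = B.invLapseSq x * B.shift x 2 := B.inverseMetric_zero_succ_eq x 2
  have g10 : B.inverseMetric x 1 0 = B.invLapseSq x * B.shift x 0 := B.inverseMetric_succ_zero_eq x 0
  have g20 : B.inverseMetric x 2 0 = B.invLapseSq x * B.shift x 1 := B.inverseMetric_succ_zero_eq x 1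
  have g30 : B.inverseMetric x 3 0 = B.invLapseSq x * B.shift x 2 := B.inverseMetric_succ_zero_eq x 2
  have g11 : B.inverseMetric x 1 1 =
      B.sliceInvMetric x 0 0 - B.invLapseSq x * B.shift x 0 * B.shift x 0 :=
    B.inverseMetric_succ_succ_eq x 0 0
  have g12 : B.inverseMetric x 1 2 =
      B.sliceInvMetric x 0 1 - B.invLapseSq x * B.shift x 0 * B.shift x 1 :=
    B.inverseMetric_succ_succ_eq x 0 1
  have g13 : B.inverseMetric x 1 3 =
      B.sliceInvMetric x 0 2 - B.invLapseSq x * B.shift x 0 * B.shift x 2 :=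
    B.inverseMetric_succ_succ_eq x 0 2
  have g21 : B.inverseMetric x 2 1 =
      B.sliceInvMetric x 1 0 - B.invLapseSq x * B.shift x 1 * B.shift x 0 :=
    B.inverseMetric_succ_succ_eq x 1 0
  have g22 : B.inverseMetric x 2 2 =
      B.sliceInvMetric x 1 1 - B.invLapseSq x * B.shift x 1 * B.shift x 1 :=
    B.inverseMetric_succ_succ_eq x 1 1
  have g23 : B.inverseMetric x 2 3 =
      B.sliceInvMetric x 1 2 - B.invLapseSq x * B.shift x 1 * B.shift x 2 :=
    B.inverseMetric_succ_succ_eq x 1 2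
  have g31 : B.inverseMetric x 3 1 =
      B.sliceInvMetric x 2 0 - B.invLapseSq x * B.shift x 2 * B.shift x 0 :=
    B.inverseMetric_succ_succ_eq x 2 0
  have g32 : B.inverseMetric x 3 2 =
      B.sliceInvMetric x 2 1 - B.invLapseSq x * B.shift x 2 * B.shift x 1 :=
    B.inverseMetric_succ_succ_eq x 2 1
  have g33 : B.inverseMetric x 3 3 =
      B.sliceInvMetric x 2 2 - B.invLapseSq x * B.shift x 2 * B.shift x 2 :=
    B.inverseMetric_succ_succ_eq x 2 2
  rw [g00, g01, g02, g03, g10, g20, g30, g11, g12, g13, g21, g22, g23, g31, g32, g33,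
    hUs 1 0, hUs 2 0, hUs 3 0, hUs 2 1, hUs 3 1, hUs 3 2]
  ring

/-- **The divergence-form wave operator in lapse–shift variables**, with the momentum variable as
any function `q0` agreeing near `x` with `∂_t u − βᵏ ∂_k u`: for `u ∈ C²` at `x`,
`□_G u (x) = −a (∂_t q₀ − βʲ ∂_j q₀) + ∑_{jk} h^{jk} ∂_j∂_k u + e⁰ q₀ + ∑_k eᵏ ∂_k u` at `x`.
[cite: John1982, Ch. 5 §3 (3.2)–(3.4)] -/
theorem waveOperator_eq_lapseShift {u : E4 → ℝ} {x : E4} (hu : ContDiffAt ℝ 2 u x)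
    {q0 : E4 → ℝ} (hq0 : q0 =ᶠ[𝓝 x] fun y ↦ fderiv ℝ u y (E4.basisVector 0) -
      ∑ k : Fin 3, B.shift y k * fderiv ℝ u y (E4.basisVector k.succ)) :
    waveOperator B.inverseMetric u x =
      -B.invLapseSq x * (fderiv ℝ q0 x (E4.basisVector 0) -
          ∑ j : Fin 3, B.shift x j * fderiv ℝ q0 x (E4.basisVector j.succ)) +
        ∑ j : Fin 3, ∑ k : Fin 3, B.sliceInvMetric x j k *
          fderiv ℝ (fderiv ℝ u) x (E4.basisVector j.succ) (E4.basisVector k.succ) +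
        B.divInvMetric x 0 * q0 x +
        ∑ k : Fin 3, B.lowCoeff x k * fderiv ℝ u x (E4.basisVector k.succ) := by
  rw [hq0.fderiv_eq, hq0.self_of_nhds]
  exact B.waveOperator_eq_lapseShift_explicit hu

end Background

end KerrSchild

end Literature.Geometry.Lorentzian

end

noncomputable section

open Set Filter Metric
open scoped ContDiff Topology

namespace Literature.Geometry.Lorentzian

namespace KerrSchild

namespace Background

variable (B : Background)

/-! ### Generic calculus on `ℝ⁴`: second derivatives along coordinate vectors -/

section Calculus

variable {X : Type*} [NormedAddCommGroup X] [NormedSpace ℝ X] {f : X → ℝ} {x : X}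

/-- For `f ∈ C²` at `x`: `∂_v (∂_w f)(x) = D²f(x)(v, w)`. [folklore] -/
theorem fderiv_fderiv_apply_eq (hf : ContDiffAt ℝ 2 f x) (v w : X) :
    fderiv ℝ (fun y ↦ fderiv ℝ f y w) x v = fderiv ℝ (fderiv ℝ f) x v w := by
  have hf2 : DifferentiableAt ℝ (fderiv ℝ f) x :=
    (hf.fderiv_right (m := 1) le_rfl).differentiableAt one_ne_zero
  have h : HasFDerivAt (fun y ↦ fderiv ℝ f y w) ((fderiv ℝ (fderiv ℝ f) x).flip w) x := by
    have := hf2.hasFDerivAt.clm_apply (hasFDerivAt_const w x)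
    simpa using this
  rw [h.fderiv]
  rfl

/-- **Symmetry of second partial derivatives** for `f ∈ C²` at `x`:
`∂_v ∂_w f (x) = ∂_w ∂_v f (x)`. [folklore] -/
theorem fderiv_fderiv_apply_comm (hf : ContDiffAt ℝ 2 f x) (v w : X) :
    fderiv ℝ (fun y ↦ fderiv ℝ f y w) x v = fderiv ℝ (fun y ↦ fderiv ℝ f y v) x w := by
  rw [fderiv_fderiv_apply_eq hf, fderiv_fderiv_apply_eq hf]
  exact hf.isSymmSndFDerivAt (by simp) v w

/-- `y ↦ ∂_w f (y)` is `C^∞` at `x` when `f` is. [folklore] -/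
theorem contDiffAt_fderiv_apply (hf : ContDiffAt ℝ ∞ f x) (w : X) :
    ContDiffAt ℝ ∞ (fun y ↦ fderiv ℝ f y w) x :=
  (hf.fderiv_right (m := ∞) le_rfl).clm_apply contDiffAt_const

/-- `y ↦ ∂_w f (y)` has derivative `D²f(x)(·, w)` at `x`. [folklore] -/
theorem hasFDerivAt_fderiv_apply (hf : ContDiffAt ℝ 2 f x) (w : X) :
    HasFDerivAt (fun y ↦ fderiv ℝ f y w) ((fderiv ℝ (fderiv ℝ f) x).flip w) x := by
  have hf2 : DifferentiableAt ℝ (fderiv ℝ f) x :=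
    (hf.fderiv_right (m := 1) le_rfl).differentiableAt one_ne_zero
  have := hf2.hasFDerivAt.clm_apply (hasFDerivAt_const w x)
  simpa using this

/-- Components of the derivative of a matrix-valued field: `(∂_v Φ)_{kj} = ∂_v (Φ_{kj})`.
[folklore] -/
theorem fderiv_apply_apply {ι κ : Type*} [Fintype ι] [Fintype κ] {Φ : X → ι → κ → ℝ}
    (hΦ : DifferentiableAt ℝ Φ x) (v : X) (k : ι) (j : κ) :
    fderiv ℝ Φ x v k j = fderiv ℝ (fun y ↦ Φ y k j) x v := by
  set L : (ι → κ → ℝ) →L[ℝ] ℝ :=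
    (ContinuousLinearMap.proj j).comp (ContinuousLinearMap.proj (R := ℝ) (φ := fun _ : ι ↦ κ → ℝ) k)
    with hL
  have hfun : (fun y ↦ Φ y k j) = L ∘ Φ := rfl
  rw [hfun, (L.hasFDerivAt.comp x hΦ.hasFDerivAt).fderiv]
  rfl

/-- Components of the derivative of a vector-valued field: `(∂_v Φ)_j = ∂_v (Φ_j)`. [folklore] -/
theorem fderiv_apply_one {ι : Type*} [Fintype ι] {Φ : X → ι → ℝ} (hΦ : DifferentiableAt ℝ Φ x) (v : X)
    (j : ι) : fderiv ℝ Φ x v j = fderiv ℝ (fun y ↦ Φ y j) x v := by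
  have hfun : (fun y ↦ Φ y j) = (ContinuousLinearMap.proj (R := ℝ) (φ := fun _ : ι ↦ ℝ) j) ∘ Φ := rfl
  rw [hfun, ((ContinuousLinearMap.proj (R := ℝ) (φ := fun _ : ι ↦ ℝ) j).hasFDerivAt.comp x
    hΦ.hasFDerivAt).fderiv]
  rfl

end Calculus

/-! ### The open slab -/

/-- The open time slab `{|x⁰| < T}`. [folklore] -/
theorem isOpen_slab (T : ℝ) : IsOpen {x : E4 | |x 0| < T} :=
  isOpen_lt (continuous_abs.comp (EuclideanSpace.proj (𝕜 := ℝ) (0 : Fin 4)).continuous)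
    continuous_const

/-- Points near a point of the open slab lie in the slab. [folklore] -/
theorem eventually_mem_slab {T : ℝ} {x : E4} (hx : |x 0| < T) : ∀ᶠ y in 𝓝 x, |y 0| < T :=
  (isOpen_slab T).mem_nhds hx

/-! ### Tangential derivatives on the initial slice -/

/-- **Tangential derivatives on the initial slice**: if a function `F`, differentiable at `(0, y)`,
restricts on `{t = 0}` to `G`, then `∂_{k+1} F (0, y) = ∂_k G (y)`. [folklore] -/
theorem fderiv_succ_of_slice_eq {F : E4 → ℝ} {G : E3 → ℝ} {y : E3}
    (hF : DifferentiableAt ℝ F (E4.ofTimeSpace 0 y)) (hFG : ∀ y', F (E4.ofTimeSpace 0 y') = G y')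
    (k : Fin 3) :
    fderiv ℝ F (E4.ofTimeSpace 0 y) (E4.basisVector k.succ) = fderiv ℝ G y (EuclideanSpace.single k 1) := by
  have hc : HasFDerivAt (fun y' ↦ F (E4.ofTimeSpace 0 y'))
      ((fderiv ℝ F (E4.ofTimeSpace 0 y)).comp E4.spaceEmbed) y :=
    hF.hasFDerivAt.comp y (E4.hasFDerivAt_ofTimeSpace 0 y)
  have hfun : (fun y' ↦ F (E4.ofTimeSpace 0 y')) = G := funext hFG
  rw [hfun] at hc
  rw [hc.fderiv, ContinuousLinearMap.comp_apply, E4.spaceEmbed_eq_sum]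
  simp only [map_sum, map_smul, PiLp.single_apply, smul_eq_mul]
  rw [Finset.sum_eq_single k]
  · simp
  · intro m _ hm; simp [hm]
  · simp

/-! ### Cauchy data of the reduced variables -/

/-- The **Cauchy data of the unsymmetrised variables** `V₀(y) = (∇ψ₀(y), ψ₁(y) − βᵏ(0,y) ∂_kψ₀(y), ψ₀(y))`
determined by coordinate Cauchy data `(u, ∂_t u)|_{t=0} = (ψ₀, ψ₁)` of the wave equation.
[cite: John1982, Ch. 5 §3] -/
def dataV (ψ₀ ψ₁ : E3 → ℝ) (y : E3) : RVec :=
  WithLp.toLp 2 (Sum.elim (fun k : Fin 3 ↦ fderiv ℝ ψ₀ y (EuclideanSpace.single k 1))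
    ![ψ₁ y - ∑ k : Fin 3, B.shift (E4.ofTimeSpace 0 y) k * fderiv ℝ ψ₀ y (EuclideanSpace.single k 1),
      ψ₀ y])

/-- The **Cauchy data of the symmetrised variables** `W₀ = S(0, ·) V₀`. [cite: John1982, Ch. 5 §3] -/
def dataW (ψ₀ ψ₁ : E3 → ℝ) (y : E3) : RVec := B.sOp (E4.ofTimeSpace 0 y) (B.dataV ψ₀ ψ₁ y)

/-- Spatial components of `V₀`: `∂_k ψ₀`. [cite: John1982, Ch. 5 §3] -/
@[simp] theorem dataV_inl (ψ₀ ψ₁ : E3 → ℝ) (y : E3) (k : Fin 3) :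
    B.dataV ψ₀ ψ₁ y (Sum.inl k) = fderiv ℝ ψ₀ y (EuclideanSpace.single k 1) := rfl

/-- The `q₀`-component of `V₀`: `ψ₁ − βᵏ ∂_kψ₀`. [cite: John1982, Ch. 5 §3] -/
@[simp] theorem dataV_inr_zero (ψ₀ ψ₁ : E3 → ℝ) (y : E3) :
    B.dataV ψ₀ ψ₁ y (Sum.inr 0) =
      ψ₁ y - ∑ k : Fin 3, B.shift (E4.ofTimeSpace 0 y) k * fderiv ℝ ψ₀ y (EuclideanSpace.single k 1) :=
  rfl

/-- The `u`-component of `V₀`: `ψ₀`. [cite: John1982, Ch. 5 §3] -/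
@[simp] theorem dataV_inr_one (ψ₀ ψ₁ : E3 → ℝ) (y : E3) : B.dataV ψ₀ ψ₁ y (Sum.inr 1) = ψ₀ y := rfl

/-! ### Classical slab solutions of the symmetrised system with Cauchy data -/

/-- **A classical solution of the symmetrised first-order system on the open slab `{|t| < T}` with
the Cauchy data of `(ψ₀, ψ₁)`**: `W` is `C^∞` at the points of the slab, satisfies there
`∂_t W = ∑_k 𝔄ᵏ ∂_k W + 𝔅 W` pointwise, and `W(0, ·) = W₀`; the data are smooth. (This is what an
existence theorem for symmetric hyperbolic systems — Friedrichs 1954 — delivers for the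
coefficients `frakAOp`, `frakBOp` and the data `dataW`.) [cite: Friedrichs1954, §1; John1982, Ch. 5 §3] -/
structure IsSymmHypSol (T : ℝ) (ψ₀ ψ₁ : E3 → ℝ) (W : E4 → RVec) : Prop where
  /-- Positivity of the half-width. -/
  pos : 0 < T
  /-- Smoothness of the data. -/
  smooth₀ : ContDiff ℝ ∞ ψ₀
  /-- Smoothness of the data. -/
  smooth₁ : ContDiff ℝ ∞ ψ₁
  /-- Smoothness of the solution at the points of the open slab. -/
  smooth : ∀ x : E4, |x 0| < T → ContDiffAt ℝ ∞ W x
  /-- The symmetrised system on the open slab. -/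
  sys : ∀ x : E4, |x 0| < T → fderiv ℝ W x (E4.basisVector 0) =
    ∑ k : Fin 3, B.frakAOp k x (fderiv ℝ W x (E4.basisVector k.succ)) + B.frakBOp x (W x)
  /-- The Cauchy data. -/
  data : ∀ y : E3, W (E4.ofTimeSpace 0 y) = B.dataW ψ₀ ψ₁ y

/-! ### The curl of the spatial variables -/

/-- The curl `ω(y)_{kj} = ∂_k q_j (y) − ∂_j q_k (y)` as a matrix-valued field.
[cite: John1982, Ch. 5 §3] -/
def curl (B : Background) (W : E4 → RVec) (y : E4) (k j : Fin 3) : ℝ :=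
  fderiv ℝ (B.qVar W j) y (E4.basisVector k.succ) - fderiv ℝ (B.qVar W k) y (E4.basisVector j.succ)

/-- Unfolding of `curl`. [cite: John1982, Ch. 5 §3] -/
theorem curl_apply (W : E4 → RVec) (y : E4) (k j : Fin 3) : curl B W y k j =
    fderiv ℝ (B.qVar W j) y (E4.basisVector k.succ) - fderiv ℝ (B.qVar W k) y (E4.basisVector j.succ) :=
  rfl

/-- The weight `C(x) = 2 ∑_{k m} |∂_kβᵐ(x)|` of the transport inequality for the curl. [folklore] -/
theorem continuous_curlWeight : Continuous fun x : E4 ↦ 2 * ∑ k : Fin 3, ∑ m : Fin 3, |B.dShift x k m| :=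
  continuous_const.mul (continuous_finsetSum _ fun k _ ↦ continuous_finsetSum _ fun m _ ↦
    (B.contDiff_dShift k m).continuous.abs)

/-- The shift as a drift has Euclidean length `< 1`. [cite: ChoquetbruhatCotsakis2002, §2 (2.4)] -/
theorem norm_driftVec_shift_le (z : E4) :
    ‖E4.driftVec (fun m y ↦ B.shift y m) z‖ ≤ 1 := by
  rw [EuclideanSpace.norm_eq, Real.sqrt_le_one]
  simp only [E4.driftVec_apply, Real.norm_eq_abs, sq_abs]
  exact (B.sum_shift_sq_lt_one z).le

/-- The **constraint defect** `r_j(y) = q_j(y) − ∂_j u(y)`. [cite: John1982, Ch. 5 §3] -/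
def defect (B : Background) (W : E4 → RVec) (y : E4) (j : Fin 3) : ℝ :=
  B.qVar W j y - fderiv ℝ (B.uVar W) y (E4.basisVector j.succ)

/-- Unfolding of `defect`. [cite: John1982, Ch. 5 §3] -/
theorem defect_apply (W : E4 → RVec) (y : E4) (j : Fin 3) :
    defect B W y j = B.qVar W j y - fderiv ℝ (B.uVar W) y (E4.basisVector j.succ) := rfl

/-- The zero drift vector. [folklore] -/
theorem driftVec_zero (z : E4) : E4.driftVec (fun (_ : Fin 3) (_ : E4) ↦ (0 : ℝ)) z = 0 := by
  ext m; simp [E4.driftVec_apply]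

namespace IsSymmHypSol

variable {B} {T : ℝ} {ψ₀ ψ₁ : E3 → ℝ} {W : E4 → RVec} (h : B.IsSymmHypSol T ψ₀ ψ₁ W)
include h

/-! #### Smoothness of the unsymmetrised variables -/

/-- `V = S⁻¹ W` is smooth at the points of the slab. [cite: John1982, Ch. 5 §3] -/
theorem contDiffAt_unsymm {x : E4} (hx : |x 0| < T) : ContDiffAt ℝ ∞ (B.unsymm W) x :=
  B.contDiff_sInvOp.contDiffAt.clm_apply (h.smooth x hx)

/-- The coordinates of `V` are smooth at the points of the slab. [folklore] -/
theorem contDiffAt_unsymm_coord {x : E4} (hx : |x 0| < T) (I : RIdx) :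
    ContDiffAt ℝ ∞ (fun y ↦ B.unsymm W y I) x :=
  (EuclideanSpace.proj (𝕜 := ℝ) I).contDiff.contDiffAt.comp x (h.contDiffAt_unsymm hx)

/-- `q_i` is smooth at the points of the slab. [cite: John1982, Ch. 5 §3] -/
theorem contDiffAt_qVar {x : E4} (hx : |x 0| < T) (i : Fin 3) : ContDiffAt ℝ ∞ (B.qVar W i) x :=
  h.contDiffAt_unsymm_coord hx (Sum.inl i)

/-- `q₀` is smooth at the points of the slab. [cite: John1982, Ch. 5 §3] -/
theorem contDiffAt_q0Var {x : E4} (hx : |x 0| < T) : ContDiffAt ℝ ∞ (B.q0Var W) x :=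
  h.contDiffAt_unsymm_coord hx (Sum.inr 0)

/-- `u` is smooth at the points of the slab. [cite: John1982, Ch. 5 §3] -/
theorem contDiffAt_uVar {x : E4} (hx : |x 0| < T) : ContDiffAt ℝ ∞ (B.uVar W) x :=
  h.contDiffAt_unsymm_coord hx (Sum.inr 1)

/-- `W` is differentiable at the points of the slab. [folklore] -/
theorem differentiableAt {x : E4} (hx : |x 0| < T) : DifferentiableAt ℝ W x :=
  (h.smooth x hx).differentiableAt (by simp)

/-! #### The component equations on the slab -/

/-- The `q⃗`-equations on the slab: `∂_t q_i = ∂_i q₀ + ∑_k βᵏ ∂_k q_i + ∑_m (∂_iβᵐ) q_m`.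
[cite: John1982, Ch. 5 §3] -/
theorem eq_q {x : E4} (hx : |x 0| < T) (i : Fin 3) :
    fderiv ℝ (B.qVar W i) x (E4.basisVector 0) =
      fderiv ℝ (B.q0Var W) x (E4.basisVector i.succ) +
        ∑ k : Fin 3, B.shift x k * fderiv ℝ (B.qVar W i) x (E4.basisVector k.succ) +
        ∑ m : Fin 3, B.dShift x i m * B.qVar W m x :=
  B.fderiv_qVar_zero_dir (h.differentiableAt hx) (h.sys x hx) i

/-- The `q₀`-equation on the slab. [cite: John1982, Ch. 5 §3] -/
theorem eq_q0 {x : E4} (hx : |x 0| < T) :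
    B.invLapseSq x * fderiv ℝ (B.q0Var W) x (E4.basisVector 0) =
      ∑ k : Fin 3, (B.invLapseSq x * B.shift x k * fderiv ℝ (B.q0Var W) x (E4.basisVector k.succ) +
        ∑ j : Fin 3, B.sliceInvMetric x k j * fderiv ℝ (B.qVar W j) x (E4.basisVector k.succ)) +
      B.divInvMetric x 0 * B.q0Var W x + ∑ j : Fin 3, B.lowCoeff x j * B.qVar W j x :=
  B.invLapseSq_mul_fderiv_q0 (h.differentiableAt hx) (h.sys x hx)

/-- The `u`-equation on the slab: `∂_t u = q₀ + ∑_j βʲ q_j`. [cite: John1982, Ch. 5 §3] -/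
theorem eq_u {x : E4} (hx : |x 0| < T) :
    fderiv ℝ (B.uVar W) x (E4.basisVector 0) = B.q0Var W x + ∑ j : Fin 3, B.shift x j * B.qVar W j x :=
  B.fderiv_uVar_zero_dir (h.differentiableAt hx) (h.sys x hx)

/-! #### The data of the unsymmetrised variables -/

/-- `V(0, y) = V₀(y)`. [cite: John1982, Ch. 5 §3] -/
theorem unsymm_data (y : E3) : B.unsymm W (E4.ofTimeSpace 0 y) = B.dataV ψ₀ ψ₁ y := by
  rw [unsymm, h.data y, dataW, B.sInvOp_sOp_apply]

/-- `q_k(0, y) = ∂_k ψ₀(y)`. [cite: John1982, Ch. 5 §3] -/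
theorem qVar_data (y : E3) (k : Fin 3) :
    B.qVar W k (E4.ofTimeSpace 0 y) = fderiv ℝ ψ₀ y (EuclideanSpace.single k 1) := by
  rw [qVar, h.unsymm_data, dataV_inl]

/-- `q₀(0, y) = ψ₁(y) − βᵏ(0, y) ∂_kψ₀(y)`. [cite: John1982, Ch. 5 §3] -/
theorem q0Var_data (y : E3) :
    B.q0Var W (E4.ofTimeSpace 0 y) =
      ψ₁ y - ∑ k : Fin 3, B.shift (E4.ofTimeSpace 0 y) k * fderiv ℝ ψ₀ y (EuclideanSpace.single k 1) := by
  rw [q0Var, h.unsymm_data, dataV_inr_zero]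

/-- `u(0, y) = ψ₀(y)`. [cite: John1982, Ch. 5 §3] -/
theorem uVar_data (y : E3) : B.uVar W (E4.ofTimeSpace 0 y) = ψ₀ y := by
  rw [uVar, h.unsymm_data, dataV_inr_one]

/-- `∂_{k+1} q_j (0, y) = ∂_k ∂_j ψ₀ (y)`. [cite: John1982, Ch. 5 §3] -/
theorem fderiv_qVar_data (y : E3) (j k : Fin 3) :
    fderiv ℝ (B.qVar W j) (E4.ofTimeSpace 0 y) (E4.basisVector k.succ) =
      fderiv ℝ (fun y' ↦ fderiv ℝ ψ₀ y' (EuclideanSpace.single j 1)) y (EuclideanSpace.single k 1) := by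
  have hx0 : |(E4.ofTimeSpace 0 y) 0| < T := by rw [E4.ofTimeSpace_apply_zero, abs_zero]; exact h.pos
  exact fderiv_succ_of_slice_eq ((h.contDiffAt_qVar hx0 j).differentiableAt (by simp))
    (fun y' ↦ h.qVar_data y' j) k

/-- `∂_{k+1} u (0, y) = ∂_k ψ₀ (y)`. [cite: John1982, Ch. 5 §3] -/
theorem fderiv_uVar_data (y : E3) (k : Fin 3) :
    fderiv ℝ (B.uVar W) (E4.ofTimeSpace 0 y) (E4.basisVector k.succ) =
      fderiv ℝ ψ₀ y (EuclideanSpace.single k 1) := by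
  have hx0 : |(E4.ofTimeSpace 0 y) 0| < T := by rw [E4.ofTimeSpace_apply_zero, abs_zero]; exact h.pos
  exact fderiv_succ_of_slice_eq ((h.contDiffAt_uVar hx0).differentiableAt (by simp)) h.uVar_data k

/-! #### Differentiating the `q⃗`-equations -/

/-- **The `q⃗`-equation differentiated along `∂_{k+1}`**: on the slab,
`∂_k ∂_t q_j = ∂_k∂_j q₀ + ∑_m ((∂_kβᵐ) ∂_m q_j + βᵐ ∂_k∂_m q_j) + ∑_m ((∂_k∂_jβᵐ) q_m + (∂_jβᵐ) ∂_k q_m)`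
(the equation holds on a neighbourhood of `x`, product rule). [cite: John1982, Ch. 5 §3] -/
theorem fderiv_eq_q {x : E4} (hx : |x 0| < T) (j k : Fin 3) :
    fderiv ℝ (fun y ↦ fderiv ℝ (B.qVar W j) y (E4.basisVector 0)) x (E4.basisVector k.succ) =
      fderiv ℝ (fun y ↦ fderiv ℝ (B.q0Var W) y (E4.basisVector j.succ)) x (E4.basisVector k.succ) +
      ∑ m : Fin 3, (B.dShift x k m * fderiv ℝ (B.qVar W j) x (E4.basisVector m.succ) +
        B.shift x m * fderiv ℝ (fun y ↦ fderiv ℝ (B.qVar W j) y (E4.basisVector m.succ)) x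
          (E4.basisVector k.succ)) +
      ∑ m : Fin 3, (fderiv ℝ (fun y ↦ B.dShift y j m) x (E4.basisVector k.succ) * B.qVar W m x +
        B.dShift x j m * fderiv ℝ (B.qVar W m) x (E4.basisVector k.succ)) := by
  -- the equation as an identity of functions near `x`
  have hev : (fun y ↦ fderiv ℝ (B.qVar W j) y (E4.basisVector 0)) =ᶠ[𝓝 x]
      fun y ↦ fderiv ℝ (B.q0Var W) y (E4.basisVector j.succ) +
        ∑ m : Fin 3, B.shift y m * fderiv ℝ (B.qVar W j) y (E4.basisVector m.succ) +
        ∑ m : Fin 3, B.dShift y j m * B.qVar W m y := by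
    filter_upwards [eventually_mem_slab hx] with y hy using h.eq_q hy j
  rw [hev.fderiv_eq]
  -- smoothness at `x`
  have h2 : (2 : WithTop ℕ∞) ≤ ∞ := WithTop.coe_le_coe.2 le_top
  have hq0 : ContDiffAt ℝ 2 (B.q0Var W) x := (h.contDiffAt_q0Var hx).of_le h2
  have hq : ∀ m, ContDiffAt ℝ 2 (B.qVar W m) x := fun m ↦ (h.contDiffAt_qVar hx m).of_le h2
  have hqd : ∀ m, DifferentiableAt ℝ (B.qVar W m) x := fun m ↦ (hq m).differentiableAt (by simp)
  have hβ2 : ∀ m, ContDiffAt ℝ 2 (fun y ↦ B.shift y m) x := fun m ↦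
    ((B.contDiff_shift m).of_le h2).contDiffAt
  have hβ : ∀ m, HasFDerivAt (fun y ↦ B.shift y m) (fderiv ℝ (fun y ↦ B.shift y m) x) x := fun m ↦
    ((B.contDiff_shift m).differentiable (by simp)).differentiableAt.hasFDerivAt
  -- the derivative of the right-hand side
  have hP1 := hasFDerivAt_fderiv_apply hq0 (E4.basisVector j.succ)
  have hP2 : ∀ m, HasFDerivAt (fun y ↦ B.shift y m * fderiv ℝ (B.qVar W j) y (E4.basisVector m.succ))
      (B.shift x m • (fderiv ℝ (fderiv ℝ (B.qVar W j)) x).flip (E4.basisVector m.succ) +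
        fderiv ℝ (B.qVar W j) x (E4.basisVector m.succ) • fderiv ℝ (fun y ↦ B.shift y m) x) x :=
    fun m ↦ (hβ m).mul (hasFDerivAt_fderiv_apply (hq j) _)
  have hP3 : ∀ m, HasFDerivAt (fun y ↦ B.dShift y j m * B.qVar W m y)
      (B.dShift x j m • fderiv ℝ (B.qVar W m) x +
        B.qVar W m x • (fderiv ℝ (fderiv ℝ (fun y ↦ B.shift y m)) x).flip (E4.basisVector j.succ)) x := by
    intro m
    have hd : HasFDerivAt (fun y ↦ B.dShift y j m)
        ((fderiv ℝ (fderiv ℝ (fun y ↦ B.shift y m)) x).flip (E4.basisVector j.succ)) x :=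
      hasFDerivAt_fderiv_apply (hβ2 m) _
    exact hd.mul (hqd m).hasFDerivAt
  have hall := (hP1.fun_add (HasFDerivAt.fun_sum (u := Finset.univ) fun m _ ↦ hP2 m)).fun_add
    (HasFDerivAt.fun_sum (u := Finset.univ) fun m _ ↦ hP3 m)
  rw [hall.fderiv]
  simp only [add_apply, FunLike.coe_sum, Finset.sum_apply, smul_apply, smul_eq_mul,
    ContinuousLinearMap.flip_apply]
  -- back to the `∂_v ∂_w` form
  rw [← fderiv_fderiv_apply_eq hq0]
  congr 1
  · congr 1
    refine Finset.sum_congr rfl fun m _ ↦ ?_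
    rw [← fderiv_fderiv_apply_eq (hq j), dShift]
    ring
  · refine Finset.sum_congr rfl fun m _ ↦ ?_
    rw [← fderiv_fderiv_apply_eq (hβ2 m)]
    simp only [dShift]
    ring

/-! #### The transport system for the curl -/

/-- **The transport identity for `ω_{kj} = ∂_k q_j − ∂_j q_k`** on the slab:
`∂_t ω_{kj} − βᵐ ∂_m ω_{kj} = (∂_kβᵐ) ω_{mj} + (∂_jβᵐ) ω_{km}` (antisymmetrise the differentiated
`q⃗`-equations; the second derivatives of `q₀`, of `q⃗` against `βᵐ`, and of `βᵐ` cancel by the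
symmetry of second derivatives). [cite: John1982, Ch. 5 §3] -/
theorem transport_curl {x : E4} (hx : |x 0| < T) (k j : Fin 3) :
    fderiv ℝ (fun y ↦ fderiv ℝ (B.qVar W j) y (E4.basisVector k.succ)) x (E4.basisVector 0) -
        fderiv ℝ (fun y ↦ fderiv ℝ (B.qVar W k) y (E4.basisVector j.succ)) x (E4.basisVector 0) -
      ∑ m : Fin 3, B.shift x m *
        (fderiv ℝ (fun y ↦ fderiv ℝ (B.qVar W j) y (E4.basisVector k.succ)) x (E4.basisVector m.succ) -
          fderiv ℝ (fun y ↦ fderiv ℝ (B.qVar W k) y (E4.basisVector j.succ)) x (E4.basisVector m.succ)) =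
      ∑ m : Fin 3, B.dShift x k m *
          (fderiv ℝ (B.qVar W j) x (E4.basisVector m.succ) - fderiv ℝ (B.qVar W m) x (E4.basisVector j.succ)) +
        ∑ m : Fin 3, B.dShift x j m *
          (fderiv ℝ (B.qVar W m) x (E4.basisVector k.succ) - fderiv ℝ (B.qVar W k) x (E4.basisVector m.succ)) := by
  have h2 : (2 : WithTop ℕ∞) ≤ ∞ := WithTop.coe_le_coe.2 le_top
  have hq0 : ContDiffAt ℝ 2 (B.q0Var W) x := (h.contDiffAt_q0Var hx).of_le h2
  have hq : ∀ m, ContDiffAt ℝ 2 (B.qVar W m) x := fun m ↦ (h.contDiffAt_qVar hx m).of_le h2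
  have hβ2 : ∀ m, ContDiffAt ℝ 2 (fun y ↦ B.shift y m) x := fun m ↦
    ((B.contDiff_shift m).of_le h2).contDiffAt
  -- `∂_t ∂_k q_j = ∂_k ∂_t q_j`, and the differentiated equations
  rw [fderiv_fderiv_apply_comm (hq j) (E4.basisVector 0) (E4.basisVector k.succ),
    fderiv_fderiv_apply_comm (hq k) (E4.basisVector 0) (E4.basisVector j.succ),
    h.fderiv_eq_q hx j k, h.fderiv_eq_q hx k j]
  -- orient the remaining second derivatives
  rw [fderiv_fderiv_apply_comm hq0 (E4.basisVector j.succ) (E4.basisVector k.succ)]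
  have hQj : ∀ m : Fin 3, fderiv ℝ (fun y ↦ fderiv ℝ (B.qVar W j) y (E4.basisVector m.succ)) x
      (E4.basisVector k.succ) =
      fderiv ℝ (fun y ↦ fderiv ℝ (B.qVar W j) y (E4.basisVector k.succ)) x (E4.basisVector m.succ) :=
    fun m ↦ fderiv_fderiv_apply_comm (hq j) _ _
  have hQk : ∀ m : Fin 3, fderiv ℝ (fun y ↦ fderiv ℝ (B.qVar W k) y (E4.basisVector m.succ)) x
      (E4.basisVector j.succ) =
      fderiv ℝ (fun y ↦ fderiv ℝ (B.qVar W k) y (E4.basisVector j.succ)) x (E4.basisVector m.succ) :=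
    fun m ↦ fderiv_fderiv_apply_comm (hq k) _ _
  have hS : ∀ m : Fin 3, fderiv ℝ (fun y ↦ B.dShift y k m) x (E4.basisVector j.succ) =
      fderiv ℝ (fun y ↦ B.dShift y j m) x (E4.basisVector k.succ) := fun m ↦ by
    simp only [dShift]
    exact fderiv_fderiv_apply_comm (hβ2 m) _ _
  simp only [hQj, hQk, hS, Fin.sum_univ_three]
  ring

/-- The curl is smooth at the points of the slab. [folklore] -/
theorem contDiffAt_curl {x : E4} (hx : |x 0| < T) : ContDiffAt ℝ ∞ (curl B W) x :=
  contDiffAt_pi.2 fun k ↦ contDiffAt_pi.2 fun j ↦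
    (contDiffAt_fderiv_apply (h.contDiffAt_qVar hx j) _).sub
      (contDiffAt_fderiv_apply (h.contDiffAt_qVar hx k) _)

/-- Components of the derivatives of the curl. [folklore] -/
theorem fderiv_curl_apply {x : E4} (hx : |x 0| < T) (v : E4) (k j : Fin 3) :
    fderiv ℝ (curl B W) x v k j =
      fderiv ℝ (fun y ↦ fderiv ℝ (B.qVar W j) y (E4.basisVector k.succ)) x v -
        fderiv ℝ (fun y ↦ fderiv ℝ (B.qVar W k) y (E4.basisVector j.succ)) x v := by
  rw [fderiv_apply_apply ((h.contDiffAt_curl hx).differentiableAt (by simp))]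
  change fderiv ℝ (fun y ↦ fderiv ℝ (B.qVar W j) y (E4.basisVector k.succ) -
    fderiv ℝ (B.qVar W k) y (E4.basisVector j.succ)) x v = _
  rw [fderiv_fun_sub ((contDiffAt_fderiv_apply (h.contDiffAt_qVar hx j) _).differentiableAt (by simp))
    ((contDiffAt_fderiv_apply (h.contDiffAt_qVar hx k) _).differentiableAt (by simp))]
  rfl

/-- **The transport inequality for the curl**: on the slab,
`‖∂_t ω − ∑_m βᵐ ∂_m ω‖ ≤ 2 (∑_{km} |∂_kβᵐ|) ‖ω‖`. [cite: John1982, Ch. 5 §3] -/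
theorem norm_transport_curl_le {x : E4} (hx : |x 0| < T) :
    ‖fderiv ℝ (curl B W) x (E4.basisVector 0) -
        ∑ m : Fin 3, B.shift x m • fderiv ℝ (curl B W) x (E4.basisVector m.succ)‖ ≤
      (2 * ∑ k : Fin 3, ∑ m : Fin 3, |B.dShift x k m|) * ‖curl B W x‖ := by
  have hω0 : 0 ≤ ‖curl B W x‖ := norm_nonneg _
  have hD0 : 0 ≤ ∑ k : Fin 3, ∑ m : Fin 3, |B.dShift x k m| :=
    Finset.sum_nonneg fun k _ ↦ Finset.sum_nonneg fun m _ ↦ abs_nonneg _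
  refine (pi_norm_le_iff_of_nonneg (by positivity)).2 fun k ↦
    (pi_norm_le_iff_of_nonneg (by positivity)).2 fun j ↦ ?_
  -- the `(k, j)` component is the transport identity
  have hcomp : (fderiv ℝ (curl B W) x (E4.basisVector 0) -
      ∑ m : Fin 3, B.shift x m • fderiv ℝ (curl B W) x (E4.basisVector m.succ)) k j =
      ∑ m : Fin 3, B.dShift x k m * curl B W x m j + ∑ m : Fin 3, B.dShift x j m * curl B W x k m := by
    simp only [Pi.sub_apply, Finset.sum_apply, Pi.smul_apply, smul_eq_mul, h.fderiv_curl_apply hx,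
      curl_apply]
    have ht := h.transport_curl hx k j
    linear_combination ht
  rw [hcomp, Real.norm_eq_abs]
  have hc : ∀ m n : Fin 3, |curl B W x m n| ≤ ‖curl B W x‖ := fun m n ↦
    (norm_le_pi_norm (curl B W x m) n).trans (norm_le_pi_norm (curl B W x) m) |>.trans_eq' (by
      rw [Real.norm_eq_abs])
  have h1 : |∑ m : Fin 3, B.dShift x k m * curl B W x m j| ≤ (∑ m : Fin 3, |B.dShift x k m|) * ‖curl B W x‖ := by
    rw [Finset.sum_mul]
    refine (Finset.abs_sum_le_sum_abs _ _).trans (Finset.sum_le_sum fun m _ ↦ ?_)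
    rw [abs_mul]
    exact mul_le_mul_of_nonneg_left (hc m j) (abs_nonneg _)
  have h2 : |∑ m : Fin 3, B.dShift x j m * curl B W x k m| ≤ (∑ m : Fin 3, |B.dShift x j m|) * ‖curl B W x‖ := by
    rw [Finset.sum_mul]
    refine (Finset.abs_sum_le_sum_abs _ _).trans (Finset.sum_le_sum fun m _ ↦ ?_)
    rw [abs_mul]
    exact mul_le_mul_of_nonneg_left (hc k m) (abs_nonneg _)
  have hk : ∑ m : Fin 3, |B.dShift x k m| ≤ ∑ k' : Fin 3, ∑ m : Fin 3, |B.dShift x k' m| :=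
    Finset.single_le_sum (f := fun k' ↦ ∑ m : Fin 3, |B.dShift x k' m|)
      (fun k' _ ↦ Finset.sum_nonneg fun m _ ↦ abs_nonneg _) (Finset.mem_univ k)
  have hj : ∑ m : Fin 3, |B.dShift x j m| ≤ ∑ k' : Fin 3, ∑ m : Fin 3, |B.dShift x k' m| :=
    Finset.single_le_sum (f := fun k' ↦ ∑ m : Fin 3, |B.dShift x k' m|)
      (fun k' _ ↦ Finset.sum_nonneg fun m _ ↦ abs_nonneg _) (Finset.mem_univ j)
  calc _ ≤ |∑ m : Fin 3, B.dShift x k m * curl B W x m j| + |∑ m : Fin 3, B.dShift x j m * curl B W x k m| :=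
        abs_add_le _ _
    _ ≤ (∑ m : Fin 3, |B.dShift x k m|) * ‖curl B W x‖ + (∑ m : Fin 3, |B.dShift x j m|) * ‖curl B W x‖ :=
        add_le_add h1 h2
    _ ≤ (2 * ∑ k' : Fin 3, ∑ m : Fin 3, |B.dShift x k' m|) * ‖curl B W x‖ := by nlinarith

/-- **The curl vanishes on the initial slice**: `ω(0, y)_{kj} = ∂_k∂_jψ₀ − ∂_j∂_kψ₀ = 0`.
[cite: John1982, Ch. 5 §3] -/
theorem curl_data (y : E3) : curl B W (E4.ofTimeSpace 0 y) = 0 := by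
  funext k j
  have h2 : ContDiffAt ℝ 2 ψ₀ y := (h.smooth₀.of_le (WithTop.coe_le_coe.2 le_top)).contDiffAt
  rw [curl_apply, h.fderiv_qVar_data, h.fderiv_qVar_data, fderiv_fderiv_apply_comm h2]
  simp

/-- **The curl vanishes on the slab**: `∂_k q_j = ∂_j q_k` at every point of `{|t| < T}`
(uniqueness for the transport system by characteristics, `E4.eq_zero_of_transport_of_data_zero`).
[cite: John1982, Ch. 5 §3] -/
theorem curl_eq_zero {x : E4} (hx : |x 0| < T) (k j : Fin 3) :
    fderiv ℝ (B.qVar W j) x (E4.basisVector k.succ) = fderiv ℝ (B.qVar W k) x (E4.basisVector j.succ) := by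
  have hz : curl B W x = 0 :=
    E4.eq_zero_of_transport_of_data_zero (β := fun m y ↦ B.shift y m)
      (C := fun x ↦ 2 * ∑ k : Fin 3, ∑ m : Fin 3, |B.dShift x k m|) (T := T) (b := 1)
      (fun m ↦ (B.contDiff_shift m).of_le (by norm_num)) B.norm_driftVec_shift_le
      (fun x hx ↦ (h.contDiffAt_curl hx).differentiableAt (by simp)) B.continuous_curlWeight
      (fun x hx ↦ h.norm_transport_curl_le hx) h.curl_data x hx
  have := congrFun (congrFun hz k) j
  rw [curl_apply, Pi.zero_apply, Pi.zero_apply, sub_eq_zero] at this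
  exact this

/-! #### The constraint `q⃗ = ∇u` -/

/-- **`∂_t ∂_j u = ∂_j q₀ + ∑_m ((∂_jβᵐ) q_m + βᵐ ∂_j q_m)`** on the slab (the `u`-equation,
differentiated along `∂_{j+1}`, with `∂_t∂_j = ∂_j∂_t`). [cite: John1982, Ch. 5 §3] -/
theorem fderiv_fderiv_uVar {x : E4} (hx : |x 0| < T) (j : Fin 3) :
    fderiv ℝ (fun y ↦ fderiv ℝ (B.uVar W) y (E4.basisVector j.succ)) x (E4.basisVector 0) =
      fderiv ℝ (B.q0Var W) x (E4.basisVector j.succ) +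
        ∑ m : Fin 3, (B.dShift x j m * B.qVar W m x + B.shift x m * fderiv ℝ (B.qVar W m) x (E4.basisVector j.succ)) := by
  have h2 : (2 : WithTop ℕ∞) ≤ ∞ := WithTop.coe_le_coe.2 le_top
  have hu : ContDiffAt ℝ 2 (B.uVar W) x := (h.contDiffAt_uVar hx).of_le h2
  rw [fderiv_fderiv_apply_comm hu]
  have hev : (fun y ↦ fderiv ℝ (B.uVar W) y (E4.basisVector 0)) =ᶠ[𝓝 x]
      fun y ↦ B.q0Var W y + ∑ m : Fin 3, B.shift y m * B.qVar W m y := by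
    filter_upwards [eventually_mem_slab hx] with y hy using h.eq_u hy
  rw [hev.fderiv_eq]
  have hq0d : DifferentiableAt ℝ (B.q0Var W) x := (h.contDiffAt_q0Var hx).differentiableAt (by simp)
  have hqd : ∀ m, DifferentiableAt ℝ (B.qVar W m) x := fun m ↦
    (h.contDiffAt_qVar hx m).differentiableAt (by simp)
  have hβ : ∀ m, HasFDerivAt (fun y ↦ B.shift y m) (fderiv ℝ (fun y ↦ B.shift y m) x) x := fun m ↦
    ((B.contDiff_shift m).differentiable (by simp)).differentiableAt.hasFDerivAt
  have hall := hq0d.hasFDerivAt.fun_add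
    (HasFDerivAt.fun_sum (u := Finset.univ) fun m _ ↦ (hβ m).fun_mul (hqd m).hasFDerivAt)
  rw [hall.fderiv]
  simp only [add_apply, FunLike.coe_sum, Finset.sum_apply, smul_apply, smul_eq_mul, dShift]
  congr 1
  exact Finset.sum_congr rfl fun m _ ↦ by ring

/-- The defect is smooth at the points of the slab. [folklore] -/
theorem contDiffAt_defect {x : E4} (hx : |x 0| < T) : ContDiffAt ℝ ∞ (defect B W) x :=
  contDiffAt_pi.2 fun j ↦ (h.contDiffAt_qVar hx j).sub (contDiffAt_fderiv_apply (h.contDiffAt_uVar hx) _)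

/-- **The defect is transported trivially**: `∂_t (q_j − ∂_j u) = ∑_m βᵐ (∂_m q_j − ∂_j q_m) = 0` on
the slab. [cite: John1982, Ch. 5 §3] -/
theorem fderiv_defect_zero {x : E4} (hx : |x 0| < T) : fderiv ℝ (defect B W) x (E4.basisVector 0) = 0 := by
  funext j
  rw [fderiv_apply_one ((h.contDiffAt_defect hx).differentiableAt (by simp)), Pi.zero_apply]
  change fderiv ℝ (fun y ↦ B.qVar W j y - fderiv ℝ (B.uVar W) y (E4.basisVector j.succ)) x
    (E4.basisVector 0) = 0
  rw [fderiv_fun_sub ((h.contDiffAt_qVar hx j).differentiableAt (by simp))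
    ((contDiffAt_fderiv_apply (h.contDiffAt_uVar hx) _).differentiableAt (by simp))]
  rw [sub_apply, h.eq_q hx j, h.fderiv_fderiv_uVar hx j]
  simp only [h.curl_eq_zero hx _ j, Finset.sum_add_distrib]
  ring

/-- The defect vanishes on the initial slice: `q_j(0, y) = ∂_jψ₀(y) = ∂_j u(0, y)`.
[cite: John1982, Ch. 5 §3] -/
theorem defect_data (y : E3) : defect B W (E4.ofTimeSpace 0 y) = 0 := by
  funext j
  rw [defect_apply, h.qVar_data, h.fderiv_uVar_data, Pi.zero_apply, sub_self]

/-- **The constraint `q⃗ = ∇u` holds on the slab**: `q_j = ∂_j u` at every point of `{|t| < T}`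
(the defect has vanishing time derivative and vanishing data; uniqueness with zero drift).
[cite: John1982, Ch. 5 §3] -/
theorem qVar_eq_fderiv_uVar {x : E4} (hx : |x 0| < T) (j : Fin 3) :
    B.qVar W j x = fderiv ℝ (B.uVar W) x (E4.basisVector j.succ) := by
  have hz : defect B W x = 0 :=
    E4.eq_zero_of_transport_of_data_zero (β := fun (_ : Fin 3) (_ : E4) ↦ (0 : ℝ))
      (C := fun _ ↦ (0 : ℝ)) (T := T) (b := 0) (fun _ ↦ contDiff_const)
      (fun z ↦ by rw [driftVec_zero, norm_zero])
      (fun x hx ↦ (h.contDiffAt_defect hx).differentiableAt (by simp)) continuous_const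
      (fun x hx ↦ by rw [h.fderiv_defect_zero hx]; simp) h.defect_data x hx
  have := congrFun hz j
  rwa [defect_apply, Pi.zero_apply, sub_eq_zero] at this

/-- **The momentum constraint on the slab**: `q₀ = ∂_t u − βᵏ ∂_k u`. [cite: John1982, Ch. 5 §3] -/
theorem q0Var_eq {x : E4} (hx : |x 0| < T) :
    B.q0Var W x = fderiv ℝ (B.uVar W) x (E4.basisVector 0) -
      ∑ k : Fin 3, B.shift x k * fderiv ℝ (B.uVar W) x (E4.basisVector k.succ) := by
  rw [h.eq_u hx]
  simp only [h.qVar_eq_fderiv_uVar hx]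
  ring

/-- The momentum constraint as an identity of functions near every point of the slab.
[cite: John1982, Ch. 5 §3] -/
theorem q0Var_eventuallyEq {x : E4} (hx : |x 0| < T) :
    B.q0Var W =ᶠ[𝓝 x] fun y ↦ fderiv ℝ (B.uVar W) y (E4.basisVector 0) -
      ∑ k : Fin 3, B.shift y k * fderiv ℝ (B.uVar W) y (E4.basisVector k.succ) := by
  filter_upwards [eventually_mem_slab hx] with y hy using h.q0Var_eq hy

end IsSymmHypSol

end Background

end KerrSchild

end Literature.Geometry.Lorentzian

end

noncomputable section

open Set Filter Metric
open scoped ContDiff Topology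

namespace Literature.Geometry.Lorentzian

namespace KerrSchild

namespace Background

namespace IsSymmHypSol

variable {B : Background} {T : ℝ} {ψ₀ ψ₁ : E3 → ℝ} {W : E4 → RVec} (h : B.IsSymmHypSol T ψ₀ ψ₁ W)
include h

/-- On the slab, `∂_k q_j = ∂_k ∂_j u` (the constraint `q⃗ = ∇u` holds near every point).
[cite: John1982, Ch. 5 §3] -/
theorem fderiv_qVar_eq {x : E4} (hx : |x 0| < T) (j : Fin 3) (v : E4) :
    fderiv ℝ (B.qVar W j) x v = fderiv ℝ (fderiv ℝ (B.uVar W)) x v (E4.basisVector j.succ) := by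
  have hev : B.qVar W j =ᶠ[𝓝 x] fun y ↦ fderiv ℝ (B.uVar W) y (E4.basisVector j.succ) := by
    filter_upwards [eventually_mem_slab hx] with y hy using h.qVar_eq_fderiv_uVar hy j
  have hu : ContDiffAt ℝ 2 (B.uVar W) x := (h.contDiffAt_uVar hx).of_le (WithTop.coe_le_coe.2 le_top)
  rw [hev.fderiv_eq, fderiv_fderiv_apply_eq hu]

/-- **The wave equation on the slab**: `□_G u = 0` at every point of `{|t| < T}` for the last
component `u` of a classical slab solution of the symmetrised system with Cauchy data.
[cite: John1982, Ch. 5 §3] -/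
theorem waveOperator_uVar {x : E4} (hx : |x 0| < T) : waveOperator B.inverseMetric (B.uVar W) x = 0 := by
  have hu : ContDiffAt ℝ 2 (B.uVar W) x := (h.contDiffAt_uVar hx).of_le (WithTop.coe_le_coe.2 le_top)
  rw [B.waveOperator_eq_lapseShift hu (h.q0Var_eventuallyEq hx)]
  have hE2 := h.eq_q0 hx
  simp only [h.fderiv_qVar_eq hx, h.qVar_eq_fderiv_uVar hx] at hE2
  simp only [Fin.sum_univ_three] at hE2 ⊢
  linear_combination (-1 : ℝ) * hE2

/-- **The time derivative on the initial slice**: `∂_t u(0, y) = ψ₁(y)` (the `u`-equation at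
`t = 0` and the data `q₀(0, ·) = ψ₁ − βᵏ∂_kψ₀`, `q⃗(0, ·) = ∇ψ₀`). [cite: John1982, Ch. 5 §3] -/
theorem fderiv_uVar_zero_data (y : E3) :
    fderiv ℝ (B.uVar W) (E4.ofTimeSpace 0 y) (E4.basisVector 0) = ψ₁ y := by
  have hx0 : |(E4.ofTimeSpace 0 y) 0| < T := by rw [E4.ofTimeSpace_apply_zero, abs_zero]; exact h.pos
  rw [h.eq_u hx0, h.q0Var_data]
  simp only [h.qVar_data]
  ring

end IsSymmHypSol

/-- **Smooth slab solutions of the wave equation from classical slab solutions of the symmetrised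
first-order system.** If `W` is a classical solution of `∂_t W = ∑_k 𝔄ᵏ ∂_k W + 𝔅 W` on
`{|t| < T}` with the Cauchy data of `(ψ₀, ψ₁)` (`IsSymmHypSol`), there is `u` (namely `u = W_u`),
`C^∞` at the points of the slab, with `□_G u = 0` there and coordinate Cauchy data `(ψ₀, ψ₁)` — the
hypothesis format of `KerrSchild.waveCauchyProblem_of_slabSolutions`.
[cite: John1982, Ch. 5 §3; Friedrichs1954, §1] -/
theorem exists_slabWave_of_isSymmHypSol (B : Background) {T : ℝ} {ψ₀ ψ₁ : E3 → ℝ} {W : E4 → RVec}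
    (h : B.IsSymmHypSol T ψ₀ ψ₁ W) :
    ∃ u : E4 → ℝ, (∀ x : E4, |x 0| < T → ContDiffAt ℝ ∞ u x) ∧
      (∀ x : E4, |x 0| < T → waveOperator B.inverseMetric u x = 0) ∧
      (∀ y : E3, u (E4.ofTimeSpace 0 y) = ψ₀ y ∧
        fderiv ℝ u (E4.ofTimeSpace 0 y) (E4.basisVector 0) = ψ₁ y) :=
  ⟨B.uVar W, fun _ hx ↦ h.contDiffAt_uVar hx, fun _ hx ↦ h.waveOperator_uVar hx,
    fun y ↦ ⟨h.uVar_data y, h.fderiv_uVar_zero_data y⟩⟩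

end Background

end KerrSchild

end Literature.Geometry.Lorentzian

end

noncomputable section

open Set Filter Metric
open scoped ContDiff Topology RealInnerProductSpace

namespace Literature.Geometry.Lorentzian

namespace KerrSchild

open Literature.Analysis.PDE

/-! ### Iterated coordinate derivatives of fields on `ℝ⁴` and word derivatives of their slices -/

section Words

variable {G : Type*} [NormedAddCommGroup G] [NormedSpace ℝ G]

/-- The iterated coordinate derivative `∂_w F` of a field on `ℝ⁴` along a word `w` of coordinate
indices (head = outermost derivative). [folklore] -/
def wordDerivE4 : List (Fin 4) → (E4 → G) → E4 → G
  | [], F => F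
  | μ :: w, F => fun x ↦ fderiv ℝ (wordDerivE4 w F) x (E4.basisVector μ)

/-- No derivative. [folklore] -/
@[simp] theorem wordDerivE4_nil (F : E4 → G) : wordDerivE4 [] F = F := rfl

/-- One more derivative, outermost. [folklore] -/
@[simp] theorem wordDerivE4_cons (μ : Fin 4) (w : List (Fin 4)) (F : E4 → G) :
    wordDerivE4 (μ :: w) F = fun x ↦ fderiv ℝ (wordDerivE4 w F) x (E4.basisVector μ) := rfl

/-- Iterated coordinate derivatives of smooth fields are smooth. [folklore] -/
theorem contDiff_wordDerivE4 {F : E4 → G} (hF : ContDiff ℝ ∞ F) (w : List (Fin 4)) :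
    ContDiff ℝ ∞ (wordDerivE4 w F) := by
  induction w with
  | nil => exact hF
  | cons μ w ih => exact (ih.fderiv_right (m := ∞) le_rfl).clm_apply contDiff_const

/-- **Iterated derivatives of a field which is constant on an open set vanish there** (and the
zeroth one is the constant). [folklore] -/
theorem wordDerivE4_eq_of_isOpen {F : E4 → G} {O : Set E4} (hO : IsOpen O) {c : G}
    (hc : ∀ x ∈ O, F x = c) (w : List (Fin 4)) :
    ∀ x ∈ O, wordDerivE4 w F x = (if w = [] then c else 0) := by
  induction w with
  | nil =>
    intro x hx
    rw [if_pos rfl]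
    exact hc x hx
  | cons μ w ih =>
    intro x hx
    rw [if_neg (List.cons_ne_nil μ w), wordDerivE4_cons]
    have hev : wordDerivE4 w F =ᶠ[𝓝 x] fun _ ↦ (if w = [] then c else 0) := by
      filter_upwards [hO.mem_nhds hx] with y hy using ih y hy
    show fderiv ℝ (wordDerivE4 w F) x (E4.basisVector μ) = 0
    rw [hev.fderiv_eq, fderiv_const_apply, zero_apply]

/-- **A word derivative of a slice is the iterated partial derivative of the field**: for `F` smooth
on `ℝ⁴`, `∂_v [y ↦ F(t, y)] (y) = (∂_{v⁺} F)(t, y)`, `v⁺` the word with shifted indices.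
[folklore] -/
theorem cwd_slice_eq {F : E4 → G} (hF : ContDiff ℝ ∞ F) (v : List (Fin 3)) (t : ℝ) :
    cwd v (fun y : E3 ↦ F (E4.ofTimeSpace t y)) =
      fun y ↦ wordDerivE4 (v.map Fin.succ) F (E4.ofTimeSpace t y) := by
  induction v with
  | nil => rfl
  | cons i v ih =>
    rw [cwd_cons, ih, List.map_cons, wordDerivE4_cons]
    funext y
    have hd : DifferentiableAt ℝ (wordDerivE4 (v.map Fin.succ) F) (E4.ofTimeSpace t y) :=
      ((contDiff_wordDerivE4 hF _).differentiable (by simp)) _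
    have hc : HasFDerivAt (fun y : E3 ↦ wordDerivE4 (v.map Fin.succ) F (E4.ofTimeSpace t y))
        ((fderiv ℝ (wordDerivE4 (v.map Fin.succ) F) (E4.ofTimeSpace t y)).comp E4.spaceEmbed) y :=
      hd.hasFDerivAt.comp y (E4.hasFDerivAt_ofTimeSpace t y)
    show fderiv ℝ (fun y : E3 ↦ wordDerivE4 (v.map Fin.succ) F (E4.ofTimeSpace t y)) y (bv i) =
      fderiv ℝ (wordDerivE4 (v.map Fin.succ) F) (E4.ofTimeSpace t y) (E4.basisVector i.succ)
    rw [hc.fderiv, ContinuousLinearMap.comp_apply, bv_eq_single, E4.spaceEmbed_eq_sum]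
    simp only [map_sum, map_smul, PiLp.single_apply]
    rw [Finset.sum_eq_single i]
    · simp
    · intro m _ hm; simp [hm]
    · simp

/-- **Uniform bounds for word derivatives of slices of a smooth field which is constant outside a
cylinder of a slab**: if `F(x) = c` whenever `|x⁰| < T' + 1` and `‖x⃗‖ > ρ`, then for every word `v`
the word derivatives `∂_v [y ↦ F(t, y)]` are bounded uniformly in `t ∈ [−T', T']` and `y ∈ ℝ³`
(continuity on the compact cylinder, constancy outside). [cite: Hormander1997, §6.3 (6.3.15)] -/
theorem exists_bound_cwd_slice {F : E4 → G} (hF : ContDiff ℝ ∞ F) {T' ρ : ℝ} {c : G}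
    (hflat : ∀ x : E4, |x 0| < T' + 1 → ρ < ‖E4.spatial x‖ → F x = c) (v : List (Fin 3)) :
    ∃ M, ∀ t ∈ Icc (-T') T', ∀ y : E3, ‖cwd v (fun y : E3 ↦ F (E4.ofTimeSpace t y)) y‖ ≤ M := by
  set w := v.map Fin.succ with hw
  -- the open flat region
  set O : Set E4 := {x | |x 0| < T' + 1 ∧ ρ < ‖E4.spatial x‖} with hO
  have hOo : IsOpen O := by
    refine (isOpen_lt (continuous_abs.comp (EuclideanSpace.proj (𝕜 := ℝ) (0 : Fin 4)).continuous)
      continuous_const).inter (isOpen_lt continuous_const (continuous_norm.comp E4.spatial.continuous))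
  have hflatO : ∀ x ∈ O, wordDerivE4 w F x = (if w = [] then c else 0) :=
    wordDerivE4_eq_of_isOpen hOo (fun x hx ↦ hflat x hx.1 hx.2) w
  -- the compact cylinder
  have hK : IsCompact ((Icc (-T') T') ×ˢ closedBall (0 : E3) (ρ + 1)) :=
    isCompact_Icc.prod (isCompact_closedBall 0 (ρ + 1))
  have hcont : Continuous fun p : ℝ × E3 ↦ ‖wordDerivE4 w F (E4.ofTimeSpace p.1 p.2)‖ :=
    continuous_norm.comp ((contDiff_wordDerivE4 hF w).continuous.comp E4.continuous_ofTimeSpace_uncurry)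
  obtain ⟨M₁, hM₁⟩ := hK.exists_bound_of_continuousOn hcont.continuousOn
  refine ⟨max M₁ ‖c‖, fun t ht y ↦ ?_⟩
  rw [cwd_slice_eq hF v t]
  change ‖wordDerivE4 w F (E4.ofTimeSpace t y)‖ ≤ _
  by_cases hy : ‖y‖ ≤ ρ + 1
  · have h1 := hM₁ (t, y) ⟨ht, mem_closedBall_zero_iff.2 hy⟩
    rw [Real.norm_eq_abs, abs_of_nonneg (norm_nonneg _)] at h1
    exact h1.trans (le_max_left _ _)
  · have hxO : E4.ofTimeSpace t y ∈ O := by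
      refine ⟨?_, ?_⟩
      · rw [E4.ofTimeSpace_apply_zero]
        exact lt_of_le_of_lt (abs_le.2 ⟨ht.1, ht.2⟩) (by linarith)
      · rw [E4.spatial_ofTimeSpace]; linarith [not_le.1 hy]
    rw [hflatO _ hxO]
    split_ifs
    · exact le_max_right _ _
    · rw [norm_zero]; exact (norm_nonneg c).trans (le_max_right _ _)

/-- **Lipschitz continuity in time of slices of a smooth field constant outside a cylinder of a
slab** (mean value theorem with the bounded time derivative). [cite: Hormander1997, §6.3 (6.3.15)] -/
theorem exists_lipschitz_slice {F : E4 → G} (hF : ContDiff ℝ ∞ F) {T' ρ : ℝ} {c : G}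
    (hflat : ∀ x : E4, |x 0| < T' + 1 → ρ < ‖E4.spatial x‖ → F x = c) :
    ∃ L, 0 ≤ L ∧ ∀ s ∈ Icc (-T') T', ∀ t ∈ Icc (-T') T', ∀ y : E3,
      ‖F (E4.ofTimeSpace t y) - F (E4.ofTimeSpace s y)‖ ≤ L * |t - s| := by
  -- bound for the time derivative `∂_0 F = wordDerivE4 [0] F` on the slab
  set O : Set E4 := {x | |x 0| < T' + 1 ∧ ρ < ‖E4.spatial x‖} with hO
  have hOo : IsOpen O := by
    refine (isOpen_lt (continuous_abs.comp (EuclideanSpace.proj (𝕜 := ℝ) (0 : Fin 4)).continuous)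
      continuous_const).inter (isOpen_lt continuous_const (continuous_norm.comp E4.spatial.continuous))
  have hflatO : ∀ x ∈ O, wordDerivE4 [0] F x = 0 := fun x hx ↦ by
    simpa using wordDerivE4_eq_of_isOpen hOo (fun x hx ↦ hflat x hx.1 hx.2) [0] x hx
  have hK : IsCompact ((Icc (-T') T') ×ˢ closedBall (0 : E3) (ρ + 1)) :=
    isCompact_Icc.prod (isCompact_closedBall 0 (ρ + 1))
  have hcont : Continuous fun p : ℝ × E3 ↦ ‖wordDerivE4 [0] F (E4.ofTimeSpace p.1 p.2)‖ :=
    continuous_norm.comp ((contDiff_wordDerivE4 hF [0]).continuous.comp E4.continuous_ofTimeSpace_uncurry)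
  obtain ⟨M₁, hM₁⟩ := hK.exists_bound_of_continuousOn hcont.continuousOn
  set L := max M₁ 0 with hL
  have hbound : ∀ t ∈ Icc (-T') T', ∀ y : E3, ‖fderiv ℝ F (E4.ofTimeSpace t y) (E4.basisVector 0)‖ ≤ L := by
    intro t ht y
    change ‖wordDerivE4 [0] F (E4.ofTimeSpace t y)‖ ≤ L
    revert t ht y
    show ∀ t ∈ Icc (-T') T', ∀ y : E3, ‖wordDerivE4 [0] F (E4.ofTimeSpace t y)‖ ≤ L
    intro t ht y
    by_cases hy : ‖y‖ ≤ ρ + 1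
    · have h1 := hM₁ (t, y) ⟨ht, mem_closedBall_zero_iff.2 hy⟩
      rw [Real.norm_eq_abs, abs_of_nonneg (norm_nonneg _)] at h1
      exact h1.trans (le_max_left _ _)
    · have hxO : E4.ofTimeSpace t y ∈ O := by
        refine ⟨?_, ?_⟩
        · rw [E4.ofTimeSpace_apply_zero]
          exact lt_of_le_of_lt (abs_le.2 ⟨ht.1, ht.2⟩) (by linarith)
        · rw [E4.spatial_ofTimeSpace]; linarith [not_le.1 hy]
      rw [hflatO _ hxO, norm_zero]; exact le_max_right _ _
  refine ⟨L, le_max_right _ _, fun s hs t ht y ↦ ?_⟩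
  -- the mean value theorem along `τ ↦ F(τ, y)`
  have hd : ∀ τ, HasDerivAt (fun τ : ℝ ↦ F (E4.ofTimeSpace τ y))
      (fderiv ℝ F (E4.ofTimeSpace τ y) (E4.basisVector 0)) τ := by
    intro τ
    have h1 : HasFDerivAt F (fderiv ℝ F (E4.ofTimeSpace τ y)) (E4.ofTimeSpace τ y) :=
      ((hF.differentiable (by simp)) _).hasFDerivAt
    exact h1.comp_hasDerivAt τ (E4.hasDerivAt_ofTimeSpace_left τ y)
  have h := Convex.norm_image_sub_le_of_norm_deriv_le (f := fun τ : ℝ ↦ F (E4.ofTimeSpace τ y))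
    (fun τ _ ↦ (hd τ).differentiableAt) (fun τ hτ ↦ by rw [(hd τ).deriv]; exact hbound τ hτ y)
    (convex_Icc (-T') T') hs ht
  simpa [Real.norm_eq_abs] using h

/-- **Lipschitz continuity in time of the word derivatives of slices** of a smooth field constant
outside a cylinder of a slab (the previous lemma applied to the iterated partial derivative, which
is again smooth and constant outside the cylinder). [cite: Hormander1997, §6.3 (6.3.15)] -/
theorem exists_lipschitz_cwd_slice {F : E4 → G} (hF : ContDiff ℝ ∞ F) {T' ρ : ℝ} {c : G}
    (hflat : ∀ x : E4, |x 0| < T' + 1 → ρ < ‖E4.spatial x‖ → F x = c) (v : List (Fin 3)) :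
    ∃ L, 0 ≤ L ∧ ∀ s ∈ Icc (-T') T', ∀ t ∈ Icc (-T') T', ∀ y : E3,
      ‖cwd v (fun y : E3 ↦ F (E4.ofTimeSpace t y)) y - cwd v (fun y : E3 ↦ F (E4.ofTimeSpace s y)) y‖ ≤
        L * |t - s| := by
  set w := v.map Fin.succ with hw
  have hO : IsOpen {x : E4 | |x 0| < T' + 1 ∧ ρ < ‖E4.spatial x‖} :=
    (isOpen_lt (continuous_abs.comp (EuclideanSpace.proj (𝕜 := ℝ) (0 : Fin 4)).continuous)
      continuous_const).inter (isOpen_lt continuous_const (continuous_norm.comp E4.spatial.continuous))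
  have hflatw : ∀ x : E4, |x 0| < T' + 1 → ρ < ‖E4.spatial x‖ →
      wordDerivE4 w F x = (if w = [] then c else 0) := fun x hx hxρ ↦
    wordDerivE4_eq_of_isOpen hO (fun x hx ↦ hflat x hx.1 hx.2) w x ⟨hx, hxρ⟩
  obtain ⟨L, hL0, hL⟩ := exists_lipschitz_slice (contDiff_wordDerivE4 hF w) hflatw
  refine ⟨L, hL0, fun s hs t ht y ↦ ?_⟩
  rw [cwd_slice_eq hF v t, cwd_slice_eq hF v s]
  exact hL s hs t ht y

end Words

namespace Background

variable (B : Background)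

/-! ### The transported coefficients -/

/-- The coefficients `Aⱼ(t, y) = 𝔄ʲ(t, y)` of the symmetrised system in the time-dependent format
of the tree's symmetric hyperbolic theory. [cite: Friedrichs1954, §1] -/
def coeffA (j : Fin 3) (t : ℝ) (y : E3) : RVec →L[ℝ] RVec := B.frakAOp j (E4.ofTimeSpace t y)

/-- The coefficient `B(t, y) = 𝔅(t, y)` of the symmetrised system in the time-dependent format.
[cite: Friedrichs1954, §1] -/
def coeffB (t : ℝ) (y : E3) : RVec →L[ℝ] RVec := B.frakBOp (E4.ofTimeSpace t y)

/-- Unfolding. [cite: Friedrichs1954, §1] -/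
theorem coeffA_apply (j : Fin 3) (t : ℝ) (y : E3) : B.coeffA j t y = B.frakAOp j (E4.ofTimeSpace t y) := rfl

/-- Unfolding. [cite: Friedrichs1954, §1] -/
theorem coeffB_apply (t : ℝ) (y : E3) : B.coeffB t y = B.frakBOp (E4.ofTimeSpace t y) := rfl

/-- `(t, y) ↦ (t, y) ∈ ℝ⁴` is smooth (affine). [folklore] -/
theorem contDiff_ofTimeSpace_uncurry : ContDiff ℝ ∞ fun p : ℝ × E3 ↦ E4.ofTimeSpace p.1 p.2 := by
  have h : (fun p : ℝ × E3 ↦ E4.ofTimeSpace p.1 p.2) = fun p ↦ p.1 • E4.basisVector 0 + E4.spaceEmbed p.2 :=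
    funext fun p ↦ E4.ofTimeSpace_eq_smul_add' p.1 p.2
  rw [h]
  exact (contDiff_fst.smul contDiff_const).add (E4.spaceEmbed.contDiff.comp contDiff_snd)

/-- `y ↦ (t, y)` is smooth. [folklore] -/
theorem contDiff_ofTimeSpace_right (t : ℝ) : ContDiff ℝ ∞ fun y : E3 ↦ E4.ofTimeSpace t y :=
  contDiff_ofTimeSpace_uncurry.comp (contDiff_const.prodMk contDiff_id)

/-- The `Aⱼ` are jointly smooth. [cite: Friedrichs1954, §1] -/
theorem contDiff_coeffA_uncurry (j : Fin 3) : ContDiff ℝ ∞ fun p : ℝ × E3 ↦ B.coeffA j p.1 p.2 :=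
  (B.contDiff_frakAOp j).comp contDiff_ofTimeSpace_uncurry

/-- `B` is jointly smooth. [cite: Friedrichs1954, §1] -/
theorem contDiff_coeffB_uncurry : ContDiff ℝ ∞ fun p : ℝ × E3 ↦ B.coeffB p.1 p.2 :=
  B.contDiff_frakBOp.comp contDiff_ofTimeSpace_uncurry

/-- The frozen `Aⱼ(t, ·)` are smooth. [cite: Friedrichs1954, §1] -/
theorem contDiff_coeffA (j : Fin 3) (t : ℝ) : ContDiff ℝ ∞ (B.coeffA j t) :=
  (B.contDiff_frakAOp j).comp (contDiff_ofTimeSpace_right t)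

/-- The frozen `B(t, ·)` is smooth. [cite: Friedrichs1954, §1] -/
theorem contDiff_coeffB (t : ℝ) : ContDiff ℝ ∞ (B.coeffB t) :=
  B.contDiff_frakBOp.comp (contDiff_ofTimeSpace_right t)

/-! ### Admissibility on tame backgrounds -/

namespace IsTame

variable {B} (hB : B.IsTame)
include hB

/-- On a tame background, for every `T'` there is `ρ` such that `φ` vanishes near every point `x`
with `|x⁰| < T' + 1` and `‖x⃗‖ > ρ`. [cite: Hormander1997, §6.3 (6.3.15)] -/
theorem exists_eventually_flat (T' : ℝ) :
    ∃ ρ, ∀ x : E4, |x 0| < T' + 1 → ρ < ‖E4.spatial x‖ → ∀ᶠ y in 𝓝 x, B.φ y = 0 := by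
  obtain ⟨ρ, hρ⟩ := hB (T' + 1)
  refine ⟨ρ, fun x hx hxρ ↦ ?_⟩
  have hO : IsOpen {z : E4 | |z 0| < T' + 1 ∧ ρ < ‖E4.spatial z‖} :=
    (isOpen_lt (continuous_abs.comp (EuclideanSpace.proj (𝕜 := ℝ) (0 : Fin 4)).continuous)
      continuous_const).inter (isOpen_lt continuous_const (continuous_norm.comp E4.spatial.continuous))
  filter_upwards [hO.mem_nhds ⟨hx, hxρ⟩] with z hz
  exact hρ z hz.1.le hz.2.le

/-- On a tame background the `𝔄ʲ` are constant outside a cylinder of every slab.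
[cite: Hormander1997, §6.3 (6.3.15)] -/
theorem exists_frakAOp_flat (T' : ℝ) (j : Fin 3) :
    ∃ ρ, ∀ x : E4, |x 0| < T' + 1 → ρ < ‖E4.spatial x‖ →
      B.frakAOp j x = Matrix.toEuclideanCLM (𝕜 := ℝ) (akFlat j) := by
  obtain ⟨ρ, hρ⟩ := hB.exists_eventually_flat T'
  exact ⟨ρ, fun x hx hxρ ↦ B.frakAOp_of_eventuallyEq (hρ x hx hxρ) j⟩

/-- On a tame background `𝔅` is constant outside a cylinder of every slab.
[cite: Hormander1997, §6.3 (6.3.15)] -/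
theorem exists_frakBOp_flat (T' : ℝ) :
    ∃ ρ, ∀ x : E4, |x 0| < T' + 1 → ρ < ‖E4.spatial x‖ →
      B.frakBOp x = Matrix.toEuclideanCLM (𝕜 := ℝ) bFlat := by
  obtain ⟨ρ, hρ⟩ := hB.exists_eventually_flat T'
  exact ⟨ρ, fun x hx hxρ ↦ B.frakBOp_of_eventuallyEq (hρ x hx hxρ)⟩

/-- **Uniform bounds for the word derivatives of the frozen coefficients of each order on compact
time intervals.** [cite: Friedrichs1954, §1; Hormander1997, §6.3 (6.3.15)] -/
theorem exists_bound_cwd (T' : ℝ) (k : ℕ) :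
    ∃ M, 0 ≤ M ∧ ∀ t ∈ Icc (-T') T',
      (∀ (j : Fin 3) (v : List (Fin 3)), v.length ≤ k + 1 → ∀ y, ‖cwd v (B.coeffA j t) y‖ ≤ M) ∧
      (∀ v : List (Fin 3), v.length ≤ k → ∀ y, ‖cwd v (B.coeffB t) y‖ ≤ M) := by
  -- bounds word by word
  have hA : ∀ (j : Fin 3) (v : List (Fin 3)), ∃ M, 0 ≤ M ∧ ∀ t ∈ Icc (-T') T', ∀ y,
      ‖cwd v (B.coeffA j t) y‖ ≤ M := by
    intro j v
    obtain ⟨ρ, hρ⟩ := hB.exists_frakAOp_flat T' j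
    obtain ⟨M, hM⟩ := exists_bound_cwd_slice (B.contDiff_frakAOp j) hρ v
    exact ⟨max M 0, le_max_right _ _, fun t ht y ↦ (hM t ht y).trans (le_max_left _ _)⟩
  have hBB : ∀ v : List (Fin 3), ∃ M, 0 ≤ M ∧ ∀ t ∈ Icc (-T') T', ∀ y,
      ‖cwd v (B.coeffB t) y‖ ≤ M := by
    intro v
    obtain ⟨ρ, hρ⟩ := hB.exists_frakBOp_flat T'
    obtain ⟨M, hM⟩ := exists_bound_cwd_slice B.contDiff_frakBOp hρ v
    exact ⟨max M 0, le_max_right _ _, fun t ht y ↦ (hM t ht y).trans (le_max_left _ _)⟩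
  choose MA hMA0 hMA using hA
  choose MB hMB0 hMB using hBB
  -- one bound for all words of length `≤ k + 1`
  refine ⟨∑ v ∈ wordsLE (Fin 3) (k + 1), ((∑ j : Fin 3, MA j v) + MB v), ?_, fun t ht ↦ ⟨?_, ?_⟩⟩
  · exact Finset.sum_nonneg fun v _ ↦ add_nonneg (Finset.sum_nonneg fun j _ ↦ hMA0 j v) (hMB0 v)
  · intro j v hv y
    have hvm : v ∈ wordsLE (Fin 3) (k + 1) := mem_wordsLE.2 hv
    calc ‖cwd v (B.coeffA j t) y‖ ≤ MA j v := hMA j v t ht y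
      _ ≤ (∑ j' : Fin 3, MA j' v) + MB v :=
          (Finset.single_le_sum (f := fun j' ↦ MA j' v) (fun j' _ ↦ hMA0 j' v) (Finset.mem_univ j)).trans
            (le_add_of_nonneg_right (hMB0 v))
      _ ≤ _ := Finset.single_le_sum (f := fun v ↦ (∑ j' : Fin 3, MA j' v) + MB v)
          (fun v _ ↦ add_nonneg (Finset.sum_nonneg fun j _ ↦ hMA0 j v) (hMB0 v)) hvm
  · intro v hv y
    have hvm : v ∈ wordsLE (Fin 3) (k + 1) := mem_wordsLE.2 (Nat.le_succ_of_le hv)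
    calc ‖cwd v (B.coeffB t) y‖ ≤ MB v := hMB v t ht y
      _ ≤ (∑ j' : Fin 3, MA j' v) + MB v := le_add_of_nonneg_left (Finset.sum_nonneg fun j _ ↦ hMA0 j v)
      _ ≤ _ := Finset.single_le_sum (f := fun v ↦ (∑ j' : Fin 3, MA j' v) + MB v)
          (fun v _ ↦ add_nonneg (Finset.sum_nonneg fun j _ ↦ hMA0 j v) (hMB0 v)) hvm

/-- **Admissibility of the frozen coefficients at every order** on compact time intervals.
[cite: Friedrichs1954, §1] -/
theorem isSymmCoeff (T' : ℝ) (k : ℕ) :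
    ∃ M, ∀ t ∈ Icc (-T') T', IsSymmCoeff k M (fun j ↦ B.coeffA j t) (B.coeffB t) := by
  obtain ⟨M, _, hM⟩ := hB.exists_bound_cwd T' k
  refine ⟨M, fun t ht ↦ ⟨fun j ↦ B.contDiff_coeffA j t, B.contDiff_coeffB t,
    fun j y u w ↦ B.inner_frakAOp_comm j _ u w, fun j v hv y ↦ (hM t ht).1 j v hv y,
    fun v hv y ↦ (hM t ht).2 v hv y⟩⟩

/-- **Lipschitz continuity in time of the coefficients at order zero**, uniformly in space, on
compact time intervals. [cite: Friedrichs1954, §1] -/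
theorem exists_lipschitz (T' : ℝ) :
    ∃ L, 0 ≤ L ∧ ∀ s ∈ Icc (-T') T', ∀ t ∈ Icc (-T') T', ∀ y : E3,
      (∀ j, ‖B.coeffA j t y - B.coeffA j s y‖ ≤ L * |t - s|) ∧ ‖B.coeffB t y - B.coeffB s y‖ ≤ L * |t - s| := by
  have hA : ∀ j : Fin 3, ∃ L, 0 ≤ L ∧ ∀ s ∈ Icc (-T') T', ∀ t ∈ Icc (-T') T', ∀ y : E3,
      ‖B.coeffA j t y - B.coeffA j s y‖ ≤ L * |t - s| := by
    intro j
    obtain ⟨ρ, hρ⟩ := hB.exists_frakAOp_flat T' j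
    exact exists_lipschitz_slice (B.contDiff_frakAOp j) hρ
  obtain ⟨ρ, hρ⟩ := hB.exists_frakBOp_flat T'
  obtain ⟨LB, hLB0, hLB⟩ := exists_lipschitz_slice B.contDiff_frakBOp hρ
  choose LA hLA0 hLA using hA
  refine ⟨(∑ j : Fin 3, LA j) + LB, add_nonneg (Finset.sum_nonneg fun j _ ↦ hLA0 j) hLB0,
    fun s hs t ht y ↦ ⟨fun j ↦ ?_, ?_⟩⟩
  · refine (hLA j s hs t ht y).trans (mul_le_mul_of_nonneg_right ?_ (abs_nonneg _))
    exact (Finset.single_le_sum (f := LA) (fun j' _ ↦ hLA0 j') (Finset.mem_univ j)).trans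
      (le_add_of_nonneg_right hLB0)
  · refine (hLB s hs t ht y).trans (mul_le_mul_of_nonneg_right ?_ (abs_nonneg _))
    exact le_add_of_nonneg_left (Finset.sum_nonneg fun j _ ↦ hLA0 j)


/-- **Lipschitz continuity in time of all spatial word derivatives of the coefficients**, uniformly
in space, on compact time intervals (the time regularity of every order used by the differentiated
regularised systems of Friedrichs' method). [cite: Friedrichs1954, §1] -/
theorem exists_lipschitz_cwd (T' : ℝ) (k : ℕ) :
    ∃ L, 0 ≤ L ∧ ∀ s ∈ Icc (-T') T', ∀ t ∈ Icc (-T') T', ∀ y : E3,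
      (∀ (j : Fin 3) (v : List (Fin 3)), v.length ≤ k →
        ‖cwd v (B.coeffA j t) y - cwd v (B.coeffA j s) y‖ ≤ L * |t - s|) ∧
      (∀ v : List (Fin 3), v.length ≤ k → ‖cwd v (B.coeffB t) y - cwd v (B.coeffB s) y‖ ≤ L * |t - s|) := by
  have hA : ∀ (j : Fin 3) (v : List (Fin 3)), ∃ L, 0 ≤ L ∧ ∀ s ∈ Icc (-T') T', ∀ t ∈ Icc (-T') T',
      ∀ y : E3, ‖cwd v (B.coeffA j t) y - cwd v (B.coeffA j s) y‖ ≤ L * |t - s| := by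
    intro j v
    obtain ⟨ρ, hρ⟩ := hB.exists_frakAOp_flat T' j
    exact exists_lipschitz_cwd_slice (B.contDiff_frakAOp j) hρ v
  have hBB : ∀ v : List (Fin 3), ∃ L, 0 ≤ L ∧ ∀ s ∈ Icc (-T') T', ∀ t ∈ Icc (-T') T',
      ∀ y : E3, ‖cwd v (B.coeffB t) y - cwd v (B.coeffB s) y‖ ≤ L * |t - s| := by
    intro v
    obtain ⟨ρ, hρ⟩ := hB.exists_frakBOp_flat T'
    exact exists_lipschitz_cwd_slice B.contDiff_frakBOp hρ v
  choose LA hLA0 hLA using hA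
  choose LB hLB0 hLB using hBB
  refine ⟨∑ v ∈ wordsLE (Fin 3) k, ((∑ j : Fin 3, LA j v) + LB v), ?_, fun s hs t ht y ↦ ⟨?_, ?_⟩⟩
  · exact Finset.sum_nonneg fun v _ ↦ add_nonneg (Finset.sum_nonneg fun j _ ↦ hLA0 j v) (hLB0 v)
  · intro j v hv
    have hvm : v ∈ wordsLE (Fin 3) k := mem_wordsLE.2 hv
    refine (hLA j v s hs t ht y).trans (mul_le_mul_of_nonneg_right ?_ (abs_nonneg _))
    calc LA j v ≤ (∑ j' : Fin 3, LA j' v) + LB v :=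
          (Finset.single_le_sum (f := fun j' ↦ LA j' v) (fun j' _ ↦ hLA0 j' v) (Finset.mem_univ j)).trans
            (le_add_of_nonneg_right (hLB0 v))
      _ ≤ _ := Finset.single_le_sum (f := fun v ↦ (∑ j' : Fin 3, LA j' v) + LB v)
          (fun v _ ↦ add_nonneg (Finset.sum_nonneg fun j _ ↦ hLA0 j v) (hLB0 v)) hvm
  · intro v hv
    have hvm : v ∈ wordsLE (Fin 3) k := mem_wordsLE.2 hv
    refine (hLB v s hs t ht y).trans (mul_le_mul_of_nonneg_right ?_ (abs_nonneg _))
    calc LB v ≤ (∑ j' : Fin 3, LA j' v) + LB v := le_add_of_nonneg_left (Finset.sum_nonneg fun j _ ↦ hLA0 j v)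
      _ ≤ _ := Finset.single_le_sum (f := fun v ↦ (∑ j' : Fin 3, LA j' v) + LB v)
          (fun v _ ↦ add_nonneg (Finset.sum_nonneg fun j _ ↦ hLA0 j v) (hLB0 v)) hvm

/-- **On a tame background the transported coefficients are an admissible symmetric family** in the
sense of the tree's symmetric hyperbolic theory (`IsSymmCoeffFamily`). [cite: Friedrichs1954, §1] -/
theorem isSymmCoeffFamily : IsSymmCoeffFamily B.coeffA B.coeffB :=
  ⟨fun T' k ↦ hB.isSymmCoeff T' k, fun T' ↦ hB.exists_lipschitz T'⟩

end IsTame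

/-! ### The Cauchy data are `C_c^∞` -/

/-- The data of the unsymmetrised variables are smooth for smooth `ψ₀, ψ₁`. [cite: John1982, Ch. 5 §3] -/
theorem contDiff_dataV {ψ₀ ψ₁ : E3 → ℝ} (h₀ : ContDiff ℝ ∞ ψ₀) (h₁ : ContDiff ℝ ∞ ψ₁) :
    ContDiff ℝ ∞ (B.dataV ψ₀ ψ₁) := by
  have hd : ∀ k : Fin 3, ContDiff ℝ ∞ fun y ↦ fderiv ℝ ψ₀ y (EuclideanSpace.single k 1) := fun k ↦
    (h₀.fderiv_right (m := ∞) le_rfl).clm_apply contDiff_const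
  have hs : ∀ k : Fin 3, ContDiff ℝ ∞ fun y : E3 ↦ B.shift (E4.ofTimeSpace 0 y) k := fun k ↦
    (B.contDiff_shift k).comp (contDiff_ofTimeSpace_right 0)
  refine contDiff_euclidean.2 fun I ↦ ?_
  rcases I with k | i
  · simpa using hd k
  · fin_cases i
    · simpa using h₁.sub (ContDiff.sum fun k _ ↦ (hs k).mul (hd k))
    · simpa using h₀

/-- The data of the symmetrised variables are smooth. [cite: John1982, Ch. 5 §3] -/
theorem contDiff_dataW {ψ₀ ψ₁ : E3 → ℝ} (h₀ : ContDiff ℝ ∞ ψ₀) (h₁ : ContDiff ℝ ∞ ψ₁) :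
    ContDiff ℝ ∞ (B.dataW ψ₀ ψ₁) :=
  (B.contDiff_sOp.comp (contDiff_ofTimeSpace_right 0)).clm_apply (B.contDiff_dataV h₀ h₁)

/-- The data of the unsymmetrised variables vanish outside the supports of `ψ₀, ψ₁`.
[cite: John1982, Ch. 5 §3] -/
theorem dataV_eq_zero {ψ₀ ψ₁ : E3 → ℝ} {y : E3} (hy : y ∉ tsupport ψ₀ ∪ tsupport ψ₁) :
    B.dataV ψ₀ ψ₁ y = 0 := by
  rw [mem_union, not_or] at hy
  have h0 : ψ₀ =ᶠ[𝓝 y] fun _ ↦ 0 := by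
    have := notMem_tsupport_iff_eventuallyEq.1 hy.1
    exact this
  have hψ₀ : ψ₀ y = 0 := h0.self_of_nhds
  have hψ₁ : ψ₁ y = 0 := image_eq_zero_of_notMem_tsupport hy.2
  have hd : fderiv ℝ ψ₀ y = 0 := by rw [h0.fderiv_eq, fderiv_const_apply]
  ext I
  rcases I with k | i
  · simp [hd]
  · fin_cases i
    · simp [hd, hψ₁]
    · simpa using hψ₀

/-- **The data of the symmetrised variables have compact support** for `C_c^∞` data `ψ₀, ψ₁`.
[cite: John1982, Ch. 5 §3] -/
theorem hasCompactSupport_dataW {ψ₀ ψ₁ : E3 → ℝ} (hc₀ : HasCompactSupport ψ₀) (hc₁ : HasCompactSupport ψ₁) :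
    HasCompactSupport (B.dataW ψ₀ ψ₁) :=
  HasCompactSupport.intro (hc₀.isCompact.union hc₁.isCompact) fun y hy ↦ by
    rw [dataW, B.dataV_eq_zero hy, map_zero]

end Background

end KerrSchild

end Literature.Geometry.Lorentzian

end

noncomputable section

open Set Filter Metric
open scoped ContDiff Topology

namespace Literature.Geometry.Lorentzian

namespace KerrSchild

open Literature.Analysis.PDE

/-! ### Transport between `ℝ⁴` and `ℝ × ℝ³` -/

namespace E4Split

/-- The linear isomorphism part `x ↦ (x⁰, x⃗)` of the splitting `ℝ⁴ = ℝ × ℝ³`, as a continuous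
linear map. [folklore] -/
def timeSpace : E4 →L[ℝ] ℝ × E3 := (EuclideanSpace.proj (𝕜 := ℝ) (0 : Fin 4)).prod E4.spatial

/-- `timeSpace x = (x⁰, x⃗)`. [folklore] -/
@[simp] theorem timeSpace_apply (x : E4) : timeSpace x = (x 0, E4.spatial x) := rfl

/-- `timeSpace ∂_0 = (1, 0)`. [folklore] -/
theorem timeSpace_basisVector_zero : timeSpace (E4.basisVector 0) = ((1 : ℝ), (0 : E3)) := by
  rw [timeSpace_apply]
  refine Prod.ext (by simp [E4.basisVector]) ?_
  ext i; simp [E4.basisVector]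

/-- `timeSpace ∂_{k+1} = (0, e_k)`. [folklore] -/
theorem timeSpace_basisVector_succ (k : Fin 3) :
    timeSpace (E4.basisVector k.succ) = ((0 : ℝ), EuclideanSpace.single k (1 : ℝ)) := by
  rw [timeSpace_apply]
  refine Prod.ext (by simp [E4.basisVector]) ?_
  ext i; simp [E4.basisVector]

end E4Split

/-! ### The assembly -/

/-- **`KerrSchild.waveCauchyProblem` from the existence of classical slab solutions of linear
symmetric hyperbolic systems with admissible coefficients and `C_c^∞` data** (Friedrichs' theorem,
taken as the hypothesis `hex` in the vocabulary of the tree's `Literature.Analysis.PDE`: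
`IsSymmCoeffFamily`, `foOp`). See the module docstring for the proof.
[cite: Friedrichs1954, §1; John1982, Ch. 5 §3; BarGinouxPfaffle2007, Thm. 3.2.11; Hormander1997, §6.3 p. 108] -/
theorem waveCauchyProblem_of_symmHyperbolic
    (hex : ∀ (A : Fin 3 → ℝ → E3 → (RVec →L[ℝ] RVec)) (Bc : ℝ → E3 → (RVec →L[ℝ] RVec)),
      IsSymmCoeffFamily A Bc →
      (∀ j, ContDiff ℝ ∞ fun p : ℝ × E3 ↦ A j p.1 p.2) → (ContDiff ℝ ∞ fun p : ℝ × E3 ↦ Bc p.1 p.2) →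
      (∀ (T' : ℝ) (k : ℕ), ∃ L, 0 ≤ L ∧ ∀ s ∈ Icc (-T') T', ∀ t ∈ Icc (-T') T', ∀ y : E3,
        (∀ (j : Fin 3) (v : List (Fin 3)), v.length ≤ k →
          ‖cwd v (A j t) y - cwd v (A j s) y‖ ≤ L * |t - s|) ∧
        (∀ v : List (Fin 3), v.length ≤ k → ‖cwd v (Bc t) y - cwd v (Bc s) y‖ ≤ L * |t - s|)) →
      ∀ U₀ : E3 → RVec, ContDiff ℝ ∞ U₀ → HasCompactSupport U₀ → ∀ T : ℝ, 0 < T →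
      ∃ U : ℝ → E3 → RVec, U 0 = U₀ ∧
        (∀ p : ℝ × E3, |p.1| < T → ContDiffAt ℝ ∞ (fun q : ℝ × E3 ↦ U q.1 q.2) p) ∧
        (∀ t : ℝ, |t| < T → ∀ y : E3,
          HasDerivAt (fun s ↦ U s y) (foOp (fun j ↦ A j t) (Bc t) (U t) y) t)) :
    waveCauchyProblem := by
  refine waveCauchyProblem_of_slabSolutions fun B hB ψ₀ ψ₁ h₀ h₁ c₀ c₁ T hT ↦ ?_
  -- solve the symmetrised system with the data of `(ψ₀, ψ₁)`
  obtain ⟨U, hU0, hUs, hUd⟩ := hex B.coeffA B.coeffB hB.isSymmCoeffFamily B.contDiff_coeffA_uncurry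
    B.contDiff_coeffB_uncurry hB.exists_lipschitz_cwd (B.dataW ψ₀ ψ₁) (B.contDiff_dataW h₀ h₁)
    (B.hasCompactSupport_dataW c₀ c₁) T hT
  -- transport to `ℝ⁴`
  set Ut : ℝ × E3 → RVec := fun q ↦ U q.1 q.2 with hUt
  set W : E4 → RVec := fun x ↦ U (x 0) (E4.spatial x) with hW
  have hWc : W = Ut ∘ E4Split.timeSpace := rfl
  -- derivatives of the transported field
  have hderiv : ∀ x : E4, |x 0| < T →
      fderiv ℝ W x (E4.basisVector 0) = foOp (fun j ↦ B.coeffA j (x 0)) (B.coeffB (x 0)) (U (x 0))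
        (E4.spatial x) ∧
      ∀ k : Fin 3, fderiv ℝ W x (E4.basisVector k.succ) =
        fderiv ℝ (U (x 0)) (E4.spatial x) (bv k) := by
    intro x hx
    have hUx : DifferentiableAt ℝ Ut (x 0, E4.spatial x) := (hUs _ hx).differentiableAt (by simp)
    have hWd : HasFDerivAt W ((fderiv ℝ Ut (x 0, E4.spatial x)).comp E4Split.timeSpace) x := by
      rw [hWc]
      exact hUx.hasFDerivAt.comp x E4Split.timeSpace.hasFDerivAt
    refine ⟨?_, fun k ↦ ?_⟩
    · -- the time derivative: uniqueness of the derivative of `s ↦ U s y`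
      rw [hWd.fderiv, ContinuousLinearMap.comp_apply, E4Split.timeSpace_basisVector_zero]
      have h1 : HasDerivAt (fun s : ℝ ↦ ((s, E4.spatial x) : ℝ × E3)) ((1 : ℝ), (0 : E3)) (x 0) :=
        (hasDerivAt_id (x 0)).prodMk (hasDerivAt_const (x 0) (E4.spatial x))
      have h2 := hUx.hasFDerivAt.comp_hasDerivAt (x 0) h1
      exact h2.unique (hUd (x 0) hx (E4.spatial x))
    · -- the spatial derivatives
      rw [hWd.fderiv, ContinuousLinearMap.comp_apply, E4Split.timeSpace_basisVector_succ]
      have h1 : HasFDerivAt (fun y : E3 ↦ ((x 0, y) : ℝ × E3)) (ContinuousLinearMap.inr ℝ ℝ E3)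
          (E4.spatial x) := hasFDerivAt_prodMk_right (x 0) (E4.spatial x)
      have h2 : HasFDerivAt (U (x 0)) ((fderiv ℝ Ut (x 0, E4.spatial x)).comp
          (ContinuousLinearMap.inr ℝ ℝ E3)) (E4.spatial x) := hUx.hasFDerivAt.comp _ h1
      rw [h2.fderiv, ContinuousLinearMap.comp_apply, ContinuousLinearMap.inr_apply, bv_eq_single]
  -- `W` is a classical slab solution of the symmetrised system with the data of `(ψ₀, ψ₁)`
  have hsol : B.IsSymmHypSol T ψ₀ ψ₁ W :=
    { pos := hT
      smooth₀ := h₀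
      smooth₁ := h₁
      smooth := fun x hx ↦ by
        rw [hWc]
        exact (hUs _ hx).comp x E4Split.timeSpace.contDiff.contDiffAt
      sys := fun x hx ↦ by
        obtain ⟨h0, hk⟩ := hderiv x hx
        have hxx : E4.ofTimeSpace (x 0) (E4.spatial x) = x := E4.ofTimeSpace_time_spatial x
        rw [h0, foOp_apply]
        simp only [hk]
        simp only [Background.coeffA_apply, Background.coeffB_apply, hxx, hW]
      data := fun y ↦ by
        simp only [hW, E4.ofTimeSpace_apply_zero, E4.spatial_ofTimeSpace, hU0] }
  exact B.exists_slabWave_of_isSymmHypSol hsol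

end KerrSchild

end Literature.Geometry.Lorentzian

end
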